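import Literature.NumberTheory.Sieve.BombieriFriedlanderIwaniecDispersionS1Rest
import HarnessLib

/-!
# Bombieri–Friedlander–Iwaniec 1986, §6 (6.8) / §7 (7.1) for Theorem 2: the squarefree reduction

Topic `Literature/NumberTheory/Sieve`.  Part of the formalisation of the provable part of the proof
of **Theorem 2** (the named fact `Literature.NumberTheory.Sieve.BombieriFriedlanderIwaniecTheorem2`)
of E. Bombieri, J. B. Friedlander, H. Iwaniec, *Primes in arithmetic progressions to large moduli*,
Acta Math. 156 (1986), 203–251.  The second method for `ℛ₁` (§9, Lemma 7 = Deshouillers–Iwaniec)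
involves the fourth moment `∑ ϱ(n)|b_n|⁴` with `ϱ(n)` the number of classes `Ω (mod n)` with
`Ω² ≡ 1`, which is `τ(n)` only for squarefree `n`; accordingly BFI restrict `𝒮₁*` to `n₁n₂`
squarefree in (6.8) ("Due to (A₄) the terms in `𝒮₁*` with `n₁n₂` not squarefree can be removed
with admissible error as in (6.4)") and remove `μ²(n₁n₂)` again from `𝒳` in §7 ((7.1): "The
arguments are the same as those for (6.4) thus we omit them").  The Theorem-1 files of the tree
(`…DispersionS1`, `…DispersionS1Rest`, `…DispersionMainTerm`) carry no `μ²`; this file PROVES the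
two removal estimates in the form `𝒮₁ᶜ(β) − 𝒮₁ᶜ(β♭)` and `𝒳(β) − 𝒳(β♭)` with `β♭ = μ²·β`
(`BFI.sqfPart`), so that the Theorem-2 assembly can run §6–§7 of the tree on `β` and §9 on `β♭`.
Everything here is PROVED; no named facts are introduced.

## The argument (made rigorous; BFI give no details)

Write `Bad = {n ∼ N : μ²(n) = 0, β_n ≠ 0}`; under (A₄) (`BFI.IsSifted` at level `z`) every such `n`
is divisible by `p²` for a prime `p > z`, so `#Bad ≤ 4N/z` (`BFI.card_nsf_support_le`) — a saving
of a power of `ℒ` only, so no pointwise divisor bound may be spent.  A pair with `n₁n₂` not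
squarefree and `β_{n₁}β_{n₂} ≠ 0` has `n₁ ∈ Bad` or `n₂ ∈ Bad`; by the swap symmetry
`(q₁,n₁) ↔ (q₂,n₂)` of `𝒮₁ᶜ` both halves agree (`BFI.abs_dS1c_sub_sqfPart_le_two_mul_vBad`).  Cauchy's
inequality is applied with the exceptional condition kept on the FREE variable
(`BFI.vBad_le`: `|β₁β₂| ≤ (θβ₂² + β₁²/θ)/2`), producing two diagonal sums of the shape
`restSum[P]` of `…DispersionS1Rest` (`A₁ ≤ B`), one with `n₂ ∈ Bad` forced and one unrestricted.
Each is bounded by `BFI.restSum_le_of_subset`: `m` outside (`BFI.restSum_eq`), the `q₂ ∼ Q` with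
`q₂r ∣ mn₂ − a` weighted by `|γ_{q₂}| ≤ τ(q₂)^B` give `τ(mn₂−a)^{B+1}`
(`BFI.innerP_le_sum_filter`; `r ∣ mn₂ − a`, `r ∣ mn₁ − a`, `(m,r)=1` force `r ∣ n₁ − n₂`), the
`m`-sum in the class `mn₁ ≡ a (q₁r)` is a Lemma-3 sum in `v = mn₂` modulo `q₁rn₂`
(`BFI.sum_mRange_class_bump_rpow_sigma_sub_le_l3`, `BFI.sum_m_cong_mul_sum_le`; level
`q₁rn₂ ≤ ((2M+Y)n₂)^{1−ε}`, i.e. `QNR ≤ x^{1−ε}`, which holds in the range of Theorem 2), and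
finally the `r ∼ R` dividing `n₁ − n₂` are summed FIRST with the weight `τ(r)^{B₃}/r ≤ τ(r)^{B₃}/R`
(`BFI.sum_dyadic_ite_dvd_rpow_div_le`), which is what makes the count of non-squarefree `n₂` in a
class modulo a large `r` unnecessary.  The result (`BFI.abs_dS1c_sub_sqfPart_le`) is
`|𝒮₁ᶜ(β) − 𝒮₁ᶜ(β♭)| ≤ 2C₃(2M+Y)lg^{B₃} Γ R⁻¹ ‖β‖² (U₁U₂)^{1/2}` with `Γ = ∑_{q∼Q}|γ_q|τ(q)^{B₃}/q`
and `U₁` (resp. `U₂`) any bound for `∑_{n₂ ∈ Bad (resp. all), n₂ ≠ n₁} τ(n₂)^{B₃}τ(|n₁−n₂|)^{B₃+1}`;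
with `#Bad ≤ 4N/N₀` and the divisor moments this is `≪ ‖β‖² x R⁻¹ ℒ^c N₀^{−1/4}`.  For `𝒳` the
same bookkeeping is elementary (`BFI.abs_calX_sub_calX_sqfPart_le`: `L > Q²R/Q₀` on the main range,
`#{r ∼ R : r ∣ n₁−n₂} ≤ τ(|n₁−n₂|)`, `BFI.nsf_pair_weight_le`).

## Contents

* `BFI.sqfPart` (`β♭`), `BFI.squarefree_of_sqfPart_ne_zero`, `BFI.abs_sqfPart_le`,
  `BFI.sqfPart_pow_le`, `BFI.l2Sq_sqfPart_le`, `BFI.isSifted_sqfPart`;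
  `BFI.card_dyadic_filter_dvd_le`, **`BFI.card_nsf_support_le`** (`#Bad ≤ 4N/z`), `BFI.tauDiff`,
  **`BFI.nsf_pair_weight_le`**, `BFI.dvd_natAbs_sub_of_solvable`,
  **`BFI.abs_calX_sub_calX_sqfPart_le`**.
* `BFI.badSet`, `BFI.sum_mRange_class_bump_rpow_sigma_sub_le_l3`, `BFI.vBad`, `BFI.sum_main_swap`,
  **`BFI.abs_dS1c_sub_sqfPart_le_two_mul_vBad`**, **`BFI.vBad_le`**, `BFI.vSh`,
  **`BFI.innerP_le_sum_filter`**, **`BFI.sum_m_cong_mul_sum_le`**, `BFI.sum_dyadic_ite_dvd_rpow_div_le`,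
  **`BFI.restSum_le_of_subset`**, `BFI.ne_of_main`, **`BFI.abs_dS1c_sub_sqfPart_le`**.

## Faithfulness

BFI assert both removals without proof ("as in (6.4)"; "the arguments are the same").  The bounds
here are stated with the Lemma-3 input (`hL3`, the exact shape of
`BombieriFriedlanderIwaniecLemma3`, PROVED in the tree as `…Lemma3_holds`), the level condition and
the divisor-sum quantities `Γ, U₁, U₂, T₁, T₂, Nn` as explicit hypotheses/parameters, to be
instantiated in the assembly (`DivisorPowerSums`); nothing is claimed beyond what is proved.

## References

* E. Bombieri, J. B. Friedlander, H. Iwaniec, Acta Math. 156 (1986), 203–251, §6 (6.4), (6.8)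
  p. 220, §7 (7.1) p. 222, §2 Lemma 3 p. 211. [BombieriFriedlanderIwaniecActa1986]
-/

noncomputable section

open Finset Real
open scoped ArithmeticFunction.sigma

namespace Literature.NumberTheory.Sieve

namespace BFI

/-- `β` restricted to squarefree arguments: `β♭_n = μ²(n) β_n`.
[cite: BombieriFriedlanderIwaniecActa1986, §6 (6.8) p. 220] -/
def sqfPart (β : ℕ → ℝ) (n : ℕ) : ℝ := if Squarefree n then β n else 0

/-- `β♭_n ≠ 0 ⟹ n` squarefree. [folklore] -/
theorem squarefree_of_sqfPart_ne_zero {β : ℕ → ℝ} {n : ℕ} (h : sqfPart β n ≠ 0) : Squarefree n := by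
  unfold sqfPart at h; by_contra hn; exact h (if_neg hn)

/-- `|β♭_n| ≤ |β_n|`. [folklore] -/
theorem abs_sqfPart_le (β : ℕ → ℝ) (n : ℕ) : |sqfPart β n| ≤ |β n| := by
  unfold sqfPart; split_ifs <;> simp

/-- `(β♭_n)^k ≤ β_n^k` for even `k ≥ 1`, hence `∑(β♭)² ≤ ∑β²`, `∑(β♭)⁴ ≤ ∑β⁴`. [folklore] -/
theorem sqfPart_pow_le (β : ℕ → ℝ) (n : ℕ) {k : ℕ} (hk : Even k) (hk0 : k ≠ 0) :
    sqfPart β n ^ k ≤ β n ^ k := by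
  unfold sqfPart; split_ifs
  · exact le_rfl
  · rw [zero_pow hk0]; exact hk.pow_nonneg _

/-- `‖β♭‖² ≤ ‖β‖²`. [folklore] -/
theorem l2Sq_sqfPart_le (N : ℝ) (β : ℕ → ℝ) : l2Sq N (sqfPart β) ≤ l2Sq N β :=
  Finset.sum_le_sum fun n _ => sqfPart_pow_le β n even_two two_ne_zero

/-- `β♭` inherits (A₄). [folklore] -/
theorem isSifted_sqfPart {S : Finset ℕ} {z : ℝ} {β : ℕ → ℝ} (h : IsSifted S z β) :
    IsSifted S z (sqfPart β) := by
  intro n hn hp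
  unfold sqfPart; split_ifs
  · exact h n hn hp
  · rfl

/-- The divisors of `d ≠ 0` lying in a dyadic range are at most `τ(d)` in number. [folklore] -/
theorem card_dyadic_filter_dvd_le (R : ℝ) {d : ℕ} (hd : d ≠ 0) :
    (((dyadic R).filter (fun r => r ∣ d)).card : ℝ) ≤ (σ 0 d : ℝ) := by
  rw [ArithmeticFunction.sigma_zero_apply]
  exact_mod_cast Finset.card_le_card (fun r hr => by
    rw [Finset.mem_filter] at hr
    exact Nat.mem_divisors.2 ⟨hr.2, hd⟩)

/-- **Non-squarefree sifted integers are rare**: if `β` vanishes at the `n ∈ (N, 2N]` having a prime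
factor `≤ z` (`z ≥ 1`), then `#{n ∼ N : μ²(n) = 0, β_n ≠ 0} ≤ 4N/z` (such `n` is divisible by `p²`
for a prime `p > z`, and `∑_{p > z} 2N/p² ≤ 4N/z`). [cite: BombieriFriedlanderIwaniecActa1986, §6 p. 220] -/
theorem card_nsf_support_le {N z : ℝ} (hN : 0 ≤ N) (hz : 1 ≤ z) {β : ℕ → ℝ}
    (hs : IsSifted (dyadic N) z β) :
    (((dyadic N).filter (fun n => ¬Squarefree n ∧ β n ≠ 0)).card : ℝ) ≤ 4 * N / z := by
  classical
  set K : ℕ := ⌊z⌋₊ with hK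
  set P : ℕ := ⌊2 * N⌋₊ with hP
  -- cover by the sets `{n ∼ N : p² ∣ n}`, `p ∈ Ioc K P`
  have hcover : (dyadic N).filter (fun n => ¬Squarefree n ∧ β n ≠ 0) ⊆
      (Finset.Ioc K P).biUnion (fun p => (dyadic N).filter (fun n => p ^ 2 ∣ n)) := by
    intro n hn
    rw [Finset.mem_filter] at hn
    obtain ⟨hnN, hnsq, hβ⟩ := hn
    have hb := (mem_dyadic hN).1 hnN
    have hn0 : n ≠ 0 := by
      rintro rfl; simp at hb; linarith
    have hex : ∃ p : ℕ, p.Prime ∧ p * p ∣ n := by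
      rw [Nat.squarefree_iff_prime_squarefree] at hnsq
      obtain ⟨p, hp⟩ := not_forall.1 hnsq
      obtain ⟨hp1, hp2⟩ := Classical.not_imp.1 hp
      exact ⟨p, hp1, not_not.1 hp2⟩
    obtain ⟨p, hp, hpn⟩ := hex
    rw [Finset.mem_biUnion]
    refine ⟨p, ?_, Finset.mem_filter.2 ⟨hnN, by rwa [sq]⟩⟩
    rw [Finset.mem_Ioc]
    have hpdvd : p ∣ n := dvd_trans (dvd_mul_right p p) hpn
    have hpz : z < (p : ℝ) := lt_of_not_ge fun h => hβ (hs n hnN ⟨p, hp, hpdvd, h⟩)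
    constructor
    · rw [hK]; exact (Nat.floor_lt (by linarith)).2 hpz
    · rw [hP]; refine Nat.le_floor ?_
      have : (p : ℝ) ≤ n := by exact_mod_cast Nat.le_of_dvd (Nat.pos_of_ne_zero hn0) hpdvd
      linarith [hb.2]
  have hcard_p : ∀ p ∈ Finset.Ioc K P, (((dyadic N).filter (fun n => p ^ 2 ∣ n)).card : ℝ) ≤
      2 * N * ((p : ℝ) ^ 2)⁻¹ := by
    intro p hp
    have hp1 : 1 ≤ p := by rw [Finset.mem_Ioc] at hp; omega
    have hp0 : (0 : ℝ) < (p : ℝ) ^ 2 := by positivity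
    have hp2 : 0 < p ^ 2 := pow_pos (by omega) 2
    -- the multiples of `p²` in `(N, 2N]` inject into `Icc 1 ⌊2N/p²⌋` via `n ↦ n/p²`
    have hsub : ((dyadic N).filter (fun n => p ^ 2 ∣ n)).card ≤ (Finset.Icc 1 ⌊2 * N / (p : ℝ) ^ 2⌋₊).card := by
      refine Finset.card_le_card_of_injOn (fun n => n / p ^ 2) (fun n hn => ?_) (fun n₁ hn₁ n₂ hn₂ h => ?_)
      · rw [Finset.mem_coe, Finset.mem_filter] at hn
        obtain ⟨hnN, k, hk⟩ := hn
        have hb := (mem_dyadic hN).1 hnN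
        dsimp only
        rw [Finset.mem_coe, Finset.mem_Icc, hk, Nat.mul_div_cancel_left _ hp2]
        have hk0 : 1 ≤ k := by
          rcases Nat.eq_zero_or_pos k with rfl | h
          · simp at hk; rw [hk] at hb; simp at hb; linarith
          · exact h
        refine ⟨hk0, Nat.le_floor ?_⟩
        rw [le_div_iff₀ hp0]
        have : ((p ^ 2 * k : ℕ) : ℝ) ≤ 2 * N := by rw [← hk]; exact hb.2
        push_cast at this; linarith
      · rw [Finset.mem_coe, Finset.mem_filter] at hn₁ hn₂
        obtain ⟨k₁, hk₁⟩ := hn₁.2; obtain ⟨k₂, hk₂⟩ := hn₂.2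
        simp only at h
        rw [hk₁, hk₂, Nat.mul_div_cancel_left _ hp2, Nat.mul_div_cancel_left _ hp2] at h
        rw [hk₁, hk₂, h]
    calc (((dyadic N).filter (fun n => p ^ 2 ∣ n)).card : ℝ)
        ≤ ((Finset.Icc 1 ⌊2 * N / (p : ℝ) ^ 2⌋₊).card : ℝ) := by exact_mod_cast hsub
      _ = ⌊2 * N / (p : ℝ) ^ 2⌋₊ := by rw [Nat.card_Icc]; push_cast; simp
      _ ≤ 2 * N / (p : ℝ) ^ 2 := Nat.floor_le (by positivity)
      _ = 2 * N * ((p : ℝ) ^ 2)⁻¹ := by rw [div_eq_mul_inv]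
  have hKz : z < (K : ℝ) + 1 := by rw [hK]; exact Nat.lt_floor_add_one z
  calc (((dyadic N).filter (fun n => ¬Squarefree n ∧ β n ≠ 0)).card : ℝ)
      ≤ (((Finset.Ioc K P).biUnion (fun p => (dyadic N).filter (fun n => p ^ 2 ∣ n))).card : ℝ) := by
        exact_mod_cast Finset.card_le_card hcover
    _ ≤ ∑ p ∈ Finset.Ioc K P, (((dyadic N).filter (fun n => p ^ 2 ∣ n)).card : ℝ) := by
        exact_mod_cast Finset.card_biUnion_le
    _ ≤ ∑ p ∈ Finset.Ioc K P, 2 * N * ((p : ℝ) ^ 2)⁻¹ := Finset.sum_le_sum hcard_p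
    _ = 2 * N * ∑ p ∈ Finset.Ioc K P, ((p : ℝ) ^ 2)⁻¹ := by rw [Finset.mul_sum]
    _ ≤ 2 * N * (2 * (((K : ℝ) + 1) ^ (2 - 1))⁻¹) :=
        mul_le_mul_of_nonneg_left (sum_Ioc_inv_pow_le_two_mul le_rfl K P) (by positivity)
    _ = 4 * N / ((K : ℝ) + 1) := by rw [show (2:ℕ) - 1 = 1 by norm_num, pow_one]; ring
    _ ≤ 4 * N / z := div_le_div_of_nonneg_left (by positivity) (by linarith) hKz.le

/-- The shifted divisor weight `τ(|n₁ − n₂|)` (`0` on the diagonal). [folklore] -/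
def tauDiff (n₁ n₂ : ℕ) : ℝ := (σ 0 (Int.natAbs ((n₁ : ℤ) - n₂)) : ℝ)

/-- `τ(|n₁ − n₂|)` is symmetric. [folklore] -/
theorem tauDiff_comm (n₁ n₂ : ℕ) : tauDiff n₁ n₂ = tauDiff n₂ n₁ := by
  unfold tauDiff; rw [← Int.natAbs_neg, neg_sub]

/-- `τ(|n₁ − n₂|) ≥ 0`. [folklore] -/
theorem tauDiff_nonneg (n₁ n₂ : ℕ) : 0 ≤ tauDiff n₁ n₂ := by unfold tauDiff; positivity

/-- **The weight of the non-squarefree pairs** (Cauchy's inequality with the non-squarefree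
condition kept on the free variable): with `T₁ ≥ ∑_{n₂∼N} τ(|n₁−n₂|)`, `T₂ ≥ ∑_{n₂∼N} τ(|n₁−n₂|)²`
(uniformly in `n₁`, diagonal excluded) and `Nn ≥ #{n ∼ N : μ²(n)=0, β_n ≠ 0}`,
`∑_{n₁,n₂∼N, ¬(μ²(n₁)=μ²(n₂)=1)} |β_{n₁}β_{n₂}| τ(|n₁−n₂|) ≤ 2‖β‖² (T₁ (Nn T₂)^{1/2})^{1/2}`.
[cite: BombieriFriedlanderIwaniecActa1986, §6 (6.4), (6.8) p. 220] -/
theorem nsf_pair_weight_le {N : ℝ} (β : ℕ → ℝ) {T₁ T₂ Nn : ℝ} (hT₁0 : 0 ≤ T₁) (hT₂0 : 0 ≤ T₂)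
    (hT₁ : ∀ n₁ ∈ dyadic N, ∑ n₂ ∈ dyadic N, tauDiff n₁ n₂ ≤ T₁)
    (hT₂ : ∀ n₁ ∈ dyadic N, ∑ n₂ ∈ dyadic N, tauDiff n₁ n₂ ^ 2 ≤ T₂)
    (hNn : ((((dyadic N).filter (fun n => ¬Squarefree n ∧ β n ≠ 0)).card : ℝ)) ≤ Nn) :
    ∑ n₁ ∈ dyadic N, ∑ n₂ ∈ dyadic N,
        (if ¬(Squarefree n₁ ∧ Squarefree n₂) then |β n₁ * β n₂| * tauDiff n₁ n₂ else 0) ≤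
      2 * l2Sq N β * Real.sqrt (T₁ * Real.sqrt (Nn * T₂)) := by
  classical
  set S := dyadic N with hS
  set Bad : Finset ℕ := S.filter (fun n => ¬Squarefree n ∧ β n ≠ 0) with hBad
  have hNn0 : 0 ≤ Nn := le_trans (by positivity) hNn
  -- the one-sided sum `U = ∑_{n₁ bad} ∑_{n₂} |β₁||β₂| τ`
  set U : ℝ := ∑ n₁ ∈ Bad, ∑ n₂ ∈ S, |β n₁| * |β n₂| * tauDiff n₁ n₂ with hU
  -- (1) reduce to `2U`
  set F : ℕ → ℕ → ℝ := fun n₁ n₂ => |β n₁| * |β n₂| * tauDiff n₁ n₂ with hF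
  have hF0 : ∀ n₁ n₂, 0 ≤ F n₁ n₂ := fun n₁ n₂ => by
    have := tauDiff_nonneg n₁ n₂; simp only [hF]; positivity
  have hFsymm : ∀ n₁ n₂, F n₂ n₁ = F n₁ n₂ := fun n₁ n₂ => by
    simp only [hF]; rw [tauDiff_comm n₂ n₁]; ring
  have hptw : ∀ n₁ ∈ S, ∀ n₂ ∈ S,
      (if ¬(Squarefree n₁ ∧ Squarefree n₂) then |β n₁ * β n₂| * tauDiff n₁ n₂ else 0) ≤
        (if n₁ ∈ Bad then F n₁ n₂ else 0) + (if n₂ ∈ Bad then F n₂ n₁ else 0) := by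
    intro n₁ hn₁ n₂ hn₂
    have ha : 0 ≤ (if n₁ ∈ Bad then F n₁ n₂ else 0) := by split_ifs; exact hF0 _ _; exact le_rfl
    have hb : 0 ≤ (if n₂ ∈ Bad then F n₂ n₁ else 0) := by split_ifs; exact hF0 _ _; exact le_rfl
    by_cases hsq : Squarefree n₁ ∧ Squarefree n₂
    · rw [if_neg (not_not.2 hsq)]; exact add_nonneg ha hb
    rw [if_pos hsq]
    have hval : |β n₁ * β n₂| * tauDiff n₁ n₂ = F n₁ n₂ := by simp only [hF]; rw [abs_mul]
    rw [hval]
    by_cases hz : β n₁ * β n₂ = 0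
    · have : F n₁ n₂ = 0 := by rw [← hval, hz, abs_zero, zero_mul]
      exact this.le.trans (add_nonneg ha hb)
    have hb1 : β n₁ ≠ 0 := fun h => hz (by rw [h, zero_mul])
    have hb2 : β n₂ ≠ 0 := fun h => hz (by rw [h, mul_zero])
    rcases not_and_or.1 hsq with h | h
    · have hmem : n₁ ∈ Bad := by rw [hBad, Finset.mem_filter]; exact ⟨hn₁, h, hb1⟩
      rw [if_pos hmem]; linarith
    · have hmem : n₂ ∈ Bad := by rw [hBad, Finset.mem_filter]; exact ⟨hn₂, h, hb2⟩
      rw [if_pos hmem, hFsymm n₁ n₂]; linarith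
  have hBadS : Bad ⊆ S := Finset.filter_subset _ _
  have hfilt : S.filter (fun n => n ∈ Bad) = Bad := by
    rw [Finset.filter_mem_eq_inter, Finset.inter_eq_right.2 hBadS]
  have hAsum : ∀ G : ℕ → ℕ → ℝ, ∑ n₁ ∈ S, ∑ n₂ ∈ S, (if n₁ ∈ Bad then G n₁ n₂ else 0) =
      ∑ n₁ ∈ Bad, ∑ n₂ ∈ S, G n₁ n₂ := by
    intro G
    calc ∑ n₁ ∈ S, ∑ n₂ ∈ S, (if n₁ ∈ Bad then G n₁ n₂ else 0)
        = ∑ n₁ ∈ S, (if n₁ ∈ Bad then ∑ n₂ ∈ S, G n₁ n₂ else 0) := by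
          refine Finset.sum_congr rfl fun n₁ _ => ?_
          split_ifs <;> simp
      _ = ∑ n₁ ∈ S.filter (fun n => n ∈ Bad), ∑ n₂ ∈ S, G n₁ n₂ := (Finset.sum_filter _ _).symm
      _ = _ := by rw [hfilt]
  have hUdef : U = ∑ n₁ ∈ Bad, ∑ n₂ ∈ S, F n₁ n₂ := by rw [hU]
  have h1 : ∑ n₁ ∈ S, ∑ n₂ ∈ S,
      (if ¬(Squarefree n₁ ∧ Squarefree n₂) then |β n₁ * β n₂| * tauDiff n₁ n₂ else 0) ≤ 2 * U := by
    calc _ ≤ ∑ n₁ ∈ S, ∑ n₂ ∈ S, ((if n₁ ∈ Bad then F n₁ n₂ else 0) +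
          (if n₂ ∈ Bad then F n₂ n₁ else 0)) :=
          Finset.sum_le_sum fun n₁ hn₁ => Finset.sum_le_sum fun n₂ hn₂ => hptw n₁ hn₁ n₂ hn₂
      _ = U + U := by
          simp only [Finset.sum_add_distrib]
          congr 1
          · rw [hAsum, hUdef]
          · rw [Finset.sum_comm, hAsum, hUdef]
      _ = 2 * U := by ring
  -- (2) Cauchy–Schwarz for `U`
  have h2 : U ≤ Real.sqrt (l2Sq N β * Real.sqrt (Nn * T₂)) * Real.sqrt (l2Sq N β * T₁) := by
    -- `U = ∑_{(n₁,n₂) ∈ Bad × S} (|β₂| √τ) (|β₁| √τ)`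
    have hUe : U = ∑ p ∈ Bad ×ˢ S, (|β p.2| * Real.sqrt (tauDiff p.1 p.2)) *
        (|β p.1| * Real.sqrt (tauDiff p.1 p.2)) := by
      rw [hUdef, Finset.sum_product]
      refine Finset.sum_congr rfl fun n₁ _ => Finset.sum_congr rfl fun n₂ _ => ?_
      have ht := tauDiff_nonneg n₁ n₂
      simp only [hF]
      calc |β n₁| * |β n₂| * tauDiff n₁ n₂
          = |β n₁| * |β n₂| * (Real.sqrt (tauDiff n₁ n₂) * Real.sqrt (tauDiff n₁ n₂)) := by
            rw [Real.mul_self_sqrt ht]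
        _ = _ := by ring
    rw [hUe]
    refine (Real.sum_mul_le_sqrt_mul_sqrt _ _ _).trans ?_
    gcongr
    · -- `∑_{bad n₁} ∑_{n₂} β₂² τ ≤ ‖β‖² · #Bad^{1/2} T₂^{1/2}`… via swapping: `∑_{n₂} β₂² ∑_{n₁ bad} τ`
      rw [Finset.sum_product]
      simp only [mul_pow, Real.sq_sqrt (tauDiff_nonneg _ _), sq_abs]
      rw [Finset.sum_comm]
      calc ∑ n₂ ∈ S, ∑ n₁ ∈ Bad, β n₂ ^ 2 * tauDiff n₁ n₂
          = ∑ n₂ ∈ S, β n₂ ^ 2 * ∑ n₁ ∈ Bad, tauDiff n₁ n₂ := by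
            simp only [Finset.mul_sum]
        _ ≤ ∑ n₂ ∈ S, β n₂ ^ 2 * Real.sqrt (Nn * T₂) := by
            refine Finset.sum_le_sum fun n₂ hn₂ => mul_le_mul_of_nonneg_left ?_ (sq_nonneg _)
            -- Cauchy–Schwarz `∑_{bad} τ · 1 ≤ √#Bad √∑τ²`
            have hcs := Real.sum_mul_le_sqrt_mul_sqrt Bad (fun n₁ => tauDiff n₁ n₂) (fun _ => (1 : ℝ))
            simp only [mul_one, one_pow, Finset.sum_const, nsmul_eq_mul, mul_one] at hcs
            refine hcs.trans ?_
            rw [← Real.sqrt_mul (Finset.sum_nonneg fun _ _ => sq_nonneg _), mul_comm Nn]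
            refine Real.sqrt_le_sqrt (mul_le_mul ?_ hNn (by positivity) hT₂0)
            calc ∑ n₁ ∈ Bad, tauDiff n₁ n₂ ^ 2 ≤ ∑ n₁ ∈ S, tauDiff n₁ n₂ ^ 2 :=
                  Finset.sum_le_sum_of_subset_of_nonneg hBadS fun _ _ _ => sq_nonneg _
              _ = ∑ n₁ ∈ S, tauDiff n₂ n₁ ^ 2 := Finset.sum_congr rfl fun n₁ _ => by rw [tauDiff_comm]
              _ ≤ T₂ := hT₂ n₂ hn₂
        _ = l2Sq N β * Real.sqrt (Nn * T₂) := by rw [← Finset.sum_mul]; rfl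
    · rw [Finset.sum_product]
      simp only [mul_pow, Real.sq_sqrt (tauDiff_nonneg _ _), sq_abs]
      calc ∑ n₁ ∈ Bad, ∑ n₂ ∈ S, β n₁ ^ 2 * tauDiff n₁ n₂
          = ∑ n₁ ∈ Bad, β n₁ ^ 2 * ∑ n₂ ∈ S, tauDiff n₁ n₂ := by simp only [Finset.mul_sum]
        _ ≤ ∑ n₁ ∈ Bad, β n₁ ^ 2 * T₁ :=
            Finset.sum_le_sum fun n₁ hn₁ => mul_le_mul_of_nonneg_left (hT₁ n₁ (hBadS hn₁)) (sq_nonneg _)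
        _ ≤ ∑ n₁ ∈ S, β n₁ ^ 2 * T₁ :=
            Finset.sum_le_sum_of_subset_of_nonneg hBadS fun _ _ _ => by positivity
        _ = l2Sq N β * T₁ := by rw [← Finset.sum_mul]; rfl
  have hl2 : 0 ≤ l2Sq N β := Finset.sum_nonneg fun _ _ => sq_nonneg _
  calc _ ≤ 2 * U := h1
    _ ≤ 2 * (Real.sqrt (l2Sq N β * Real.sqrt (Nn * T₂)) * Real.sqrt (l2Sq N β * T₁)) := by linarith
    _ = 2 * l2Sq N β * Real.sqrt (T₁ * Real.sqrt (Nn * T₂)) := by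
        rw [← Real.sqrt_mul (by positivity), show l2Sq N β * Real.sqrt (Nn * T₂) * (l2Sq N β * T₁) =
          (l2Sq N β) ^ 2 * (T₁ * Real.sqrt (Nn * T₂)) by ring, Real.sqrt_mul (sq_nonneg _),
          Real.sqrt_sq hl2]; ring


/-- Under `Solvable`, `r ∣ |n₁ − n₂|`. [folklore] -/
theorem dvd_natAbs_sub_of_solvable {a : ℤ} {r q₁ q₂ n₁ n₂ : ℕ} (hr : 0 < r) (hq₁ : 0 < q₁)
    (hq₂ : 0 < q₂) (h : Solvable a r q₁ q₂ n₁ n₂) : r ∣ Int.natAbs ((n₁ : ℤ) - n₂) := by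
  obtain ⟨_, _, _, h4⟩ := (solvable_iff hr hq₁ hq₂ n₁ n₂).1 h
  have hmod := (ZMod.natCast_eq_natCast_iff _ _ _).1 h4
  have hg : (gmod r q₁ q₂ : ℤ) ∣ (n₁ : ℤ) - n₂ := Nat.modEq_iff_dvd.1 hmod.symm
  have hr' : (r : ℤ) ∣ (n₁ : ℤ) - n₂ := dvd_trans (by unfold gmod; push_cast; exact dvd_mul_left _ _) hg
  have := Int.natAbs_dvd_natAbs.2 hr'
  simpa using this

/-- **`𝒳(β) − 𝒳(β♭)`**: the pairs with `n₁n₂` not squarefree contribute to `𝒳` at most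
`(Q₀/(Q²R)) (∑_{q∼Q}|γ_q|)² · 2‖β‖² (T₁ (Nn T₂)^{1/2})^{1/2}` (on the main range `L > Q²R/Q₀`; the
`r ∼ R` with `r ∣ n₁ − n₂` are at most `τ(|n₁−n₂|)`; then `BFI.nsf_pair_weight_le`).
[cite: BombieriFriedlanderIwaniecActa1986, §7 (7.1) p. 222, §6 (6.8) p. 220] -/
theorem abs_calX_sub_calX_sqfPart_le {a : ℤ} (N : ℝ) {Q R Q₀ : ℝ} (hQ : 0 < Q) (hR : 0 < R)
    (hQ₀ : 0 < Q₀) (β γ : ℕ → ℝ) {T₁ T₂ Nn : ℝ} (hT₁0 : 0 ≤ T₁) (hT₂0 : 0 ≤ T₂)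
    (hT₁ : ∀ n₁ ∈ dyadic N, ∑ n₂ ∈ dyadic N, tauDiff n₁ n₂ ≤ T₁)
    (hT₂ : ∀ n₁ ∈ dyadic N, ∑ n₂ ∈ dyadic N, tauDiff n₁ n₂ ^ 2 ≤ T₂)
    (hNn : ((((dyadic N).filter (fun n => ¬Squarefree n ∧ β n ≠ 0)).card : ℝ)) ≤ Nn) :
    |calX a N Q R Q₀ β γ - calX a N Q R Q₀ (sqfPart β) γ| ≤
      Q₀ / (Q ^ 2 * R) * (∑ q ∈ dyadic Q, |γ q|) ^ 2 *
        (2 * l2Sq N β * Real.sqrt (T₁ * Real.sqrt (Nn * T₂))) := by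
  classical
  set c : ℝ := Q₀ / (Q ^ 2 * R) with hc
  have hc0 : 0 ≤ c := by positivity
  -- the difference, termwise
  set D : ℕ → ℕ → ℕ → ℕ → ℕ → ℝ := fun r q₁ q₂ n₁ n₂ =>
    if (Main Q₀ q₁ q₂ n₁ n₂ ∧ Solvable a r q₁ q₂ n₁ n₂) ∧ ¬(Squarefree n₁ ∧ Squarefree n₂) then
      γ q₁ * γ q₂ * β n₁ * β n₂ / (lmod r q₁ q₂ : ℝ) else 0 with hD
  have hdiff : calX a N Q R Q₀ β γ - calX a N Q R Q₀ (sqfPart β) γ =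
      ∑ r ∈ dyadic R, ∑ q₁ ∈ dyadic Q, ∑ q₂ ∈ dyadic Q, ∑ n₁ ∈ dyadic N, ∑ n₂ ∈ dyadic N,
        D r q₁ q₂ n₁ n₂ := by
    unfold calX
    simp only [← Finset.sum_sub_distrib]
    refine Finset.sum_congr rfl fun r _ => Finset.sum_congr rfl fun q₁ _ =>
      Finset.sum_congr rfl fun q₂ _ => Finset.sum_congr rfl fun n₁ _ =>
      Finset.sum_congr rfl fun n₂ _ => ?_
    simp only [hD]
    by_cases hMS : Main Q₀ q₁ q₂ n₁ n₂ ∧ Solvable a r q₁ q₂ n₁ n₂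
    · rw [if_pos hMS, if_pos hMS]
      by_cases hsq : Squarefree n₁ ∧ Squarefree n₂
      · rw [if_neg (fun h => h.2 hsq)]
        unfold sqfPart; rw [if_pos hsq.1, if_pos hsq.2, sub_self]
      · rw [if_pos ⟨hMS, hsq⟩]
        have : sqfPart β n₁ * sqfPart β n₂ = 0 := by
          unfold sqfPart
          rcases not_and_or.1 hsq with h | h
          · rw [if_neg h, zero_mul]
          · rw [if_neg h, mul_zero]
        rw [mul_assoc (γ q₁ * γ q₂) (sqfPart β n₁), this, mul_zero, zero_div, sub_zero]
    · rw [if_neg hMS, if_neg hMS, if_neg (fun h => hMS h.1), sub_self]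
  -- termwise bound
  set W : ℕ → ℕ → ℝ := fun n₁ n₂ =>
    if ¬(Squarefree n₁ ∧ Squarefree n₂) ∧ n₁ ≠ n₂ then |β n₁ * β n₂| else 0 with hW
  have hW0 : ∀ n₁ n₂, 0 ≤ W n₁ n₂ := fun n₁ n₂ => by simp only [hW]; split_ifs; positivity; rfl
  have hterm : ∀ r ∈ dyadic R, ∀ q₁ ∈ dyadic Q, ∀ q₂ ∈ dyadic Q, ∀ n₁ n₂ : ℕ,
      |D r q₁ q₂ n₁ n₂| ≤ c * (|γ q₁| * |γ q₂|) *
        (W n₁ n₂ * (if r ∣ Int.natAbs ((n₁ : ℤ) - n₂) then 1 else 0)) := by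
    intro r hr q₁ hq₁ q₂ hq₂ n₁ n₂
    have hrb := (mem_dyadic hR.le).1 hr
    have hq₁b := (mem_dyadic hQ.le).1 hq₁
    have hq₂b := (mem_dyadic hQ.le).1 hq₂
    have hr0 : 0 < r := pos_of_mem_dyadic hR.le hr
    have hq₁0 : 0 < q₁ := pos_of_mem_dyadic hQ.le hq₁
    have hq₂0 : 0 < q₂ := pos_of_mem_dyadic hQ.le hq₂
    simp only [hD]
    by_cases hcond : (Main Q₀ q₁ q₂ n₁ n₂ ∧ Solvable a r q₁ q₂ n₁ n₂) ∧ ¬(Squarefree n₁ ∧ Squarefree n₂)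
    · obtain ⟨⟨hM, hS⟩, hsq⟩ := hcond
      have hne : n₁ ≠ n₂ := by
        rintro rfl
        have h1 : n₁ = 1 := by simpa using hM.1
        exact hsq ⟨by rw [h1]; exact squarefree_one, by rw [h1]; exact squarefree_one⟩
      rw [if_pos ⟨⟨hM, hS⟩, hsq⟩, if_pos (dvd_natAbs_sub_of_solvable hr0 hq₁0 hq₂0 hS)]
      simp only [hW]; rw [if_pos ⟨hsq, hne⟩]
      -- `1/L ≤ c`
      have hL0 : 0 < lmod r q₁ q₂ := lmod_pos hr0 hq₁0 hq₂0
      have hLc : ((lmod r q₁ q₂ : ℕ) : ℝ)⁻¹ ≤ c := by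
        have hmul : ((lmod r q₁ q₂ : ℕ) : ℝ) * (Nat.gcd q₁ q₂ : ℝ) = (q₁ : ℝ) * q₂ * r := by
          exact_mod_cast lmod_mul_gcd r q₁ q₂
        have hge : Q ^ 2 * R ≤ (lmod r q₁ q₂ : ℝ) * Q₀ := by
          calc Q ^ 2 * R ≤ (q₁ : ℝ) * q₂ * r := by
                have h1 : Q ^ 2 ≤ (q₁ : ℝ) * q₂ := by
                  rw [sq]; exact mul_le_mul hq₁b.1.le hq₂b.1.le hQ.le (by positivity)
                exact mul_le_mul h1 hrb.1.le hR.le (by positivity)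
            _ = (lmod r q₁ q₂ : ℝ) * (Nat.gcd q₁ q₂ : ℝ) := hmul.symm
            _ ≤ (lmod r q₁ q₂ : ℝ) * Q₀ := mul_le_mul_of_nonneg_left hM.2 (by positivity)
        rw [hc, inv_eq_one_div, div_le_div_iff₀ (by exact_mod_cast hL0) (by positivity), one_mul]
        linarith
      rw [abs_div, Nat.abs_cast, div_eq_mul_inv, abs_mul (γ q₁ * γ q₂ * β n₁), abs_mul (γ q₁ * γ q₂),
        abs_mul (γ q₁), abs_mul (β n₁)]
      calc |γ q₁| * |γ q₂| * |β n₁| * |β n₂| * ((lmod r q₁ q₂ : ℕ) : ℝ)⁻¹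
          ≤ |γ q₁| * |γ q₂| * |β n₁| * |β n₂| * c := by gcongr
        _ = c * (|γ q₁| * |γ q₂|) * (|β n₁| * |β n₂| * 1) := by ring
    · rw [if_neg hcond, abs_zero]
      have : 0 ≤ (if r ∣ Int.natAbs ((n₁ : ℤ) - n₂) then (1 : ℝ) else 0) := by split_ifs <;> norm_num
      have := hW0 n₁ n₂
      positivity
  -- `W · #{r ∣ n₁ - n₂} ≤ [nsf] |β₁β₂| τ(|n₁−n₂|)`
  have hWcount : ∀ n₁ n₂ : ℕ,
      W n₁ n₂ * ∑ r ∈ dyadic R, (if r ∣ Int.natAbs ((n₁ : ℤ) - n₂) then (1 : ℝ) else 0) ≤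
        (if ¬(Squarefree n₁ ∧ Squarefree n₂) then |β n₁ * β n₂| * tauDiff n₁ n₂ else 0) := by
    intro n₁ n₂
    simp only [hW]
    by_cases h : ¬(Squarefree n₁ ∧ Squarefree n₂) ∧ n₁ ≠ n₂
    · rw [if_pos h, if_pos h.1]
      have hd : Int.natAbs ((n₁ : ℤ) - n₂) ≠ 0 := by rw [Int.natAbs_ne_zero]; omega
      refine mul_le_mul_of_nonneg_left ?_ (abs_nonneg _)
      rw [← Finset.sum_filter, Finset.sum_const, nsmul_eq_mul, mul_one]
      exact card_dyadic_filter_dvd_le R hd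
    · rw [if_neg h, zero_mul]
      by_cases h' : ¬(Squarefree n₁ ∧ Squarefree n₂)
      · rw [if_pos h']; have := tauDiff_nonneg n₁ n₂; positivity
      · rw [if_neg h']
  -- sum up, move `r` inside
  rw [hdiff]
  refine (Finset.abs_sum_le_sum_abs _ _).trans ?_
  calc ∑ r ∈ dyadic R, |∑ q₁ ∈ dyadic Q, ∑ q₂ ∈ dyadic Q, ∑ n₁ ∈ dyadic N, ∑ n₂ ∈ dyadic N, D r q₁ q₂ n₁ n₂|
      ≤ ∑ r ∈ dyadic R, ∑ q₁ ∈ dyadic Q, ∑ q₂ ∈ dyadic Q, ∑ n₁ ∈ dyadic N, ∑ n₂ ∈ dyadic N,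
          c * (|γ q₁| * |γ q₂|) *
            (W n₁ n₂ * (if r ∣ Int.natAbs ((n₁ : ℤ) - n₂) then 1 else 0)) := by
        refine Finset.sum_le_sum fun r hr => (Finset.abs_sum_le_sum_abs _ _).trans
          (Finset.sum_le_sum fun q₁ hq₁ => (Finset.abs_sum_le_sum_abs _ _).trans
          (Finset.sum_le_sum fun q₂ hq₂ => (Finset.abs_sum_le_sum_abs _ _).trans
          (Finset.sum_le_sum fun n₁ _ => (Finset.abs_sum_le_sum_abs _ _).trans
          (Finset.sum_le_sum fun n₂ _ => hterm r hr q₁ hq₁ q₂ hq₂ n₁ n₂))))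
    _ = c * ∑ q₁ ∈ dyadic Q, ∑ q₂ ∈ dyadic Q, |γ q₁| * |γ q₂| *
          ∑ n₁ ∈ dyadic N, ∑ n₂ ∈ dyadic N,
            (W n₁ n₂ * ∑ r ∈ dyadic R, (if r ∣ Int.natAbs ((n₁ : ℤ) - n₂) then (1 : ℝ) else 0)) := by
        rw [Finset.sum_comm]
        simp only [Finset.mul_sum]
        refine Finset.sum_congr rfl fun q₁ _ => ?_
        rw [Finset.sum_comm]
        refine Finset.sum_congr rfl fun q₂ _ => ?_
        rw [Finset.sum_comm]
        refine Finset.sum_congr rfl fun n₁ _ => ?_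
        rw [Finset.sum_comm]
        refine Finset.sum_congr rfl fun n₂ _ => ?_
        refine Finset.sum_congr rfl fun r _ => by ring
    _ ≤ c * ∑ q₁ ∈ dyadic Q, ∑ q₂ ∈ dyadic Q, |γ q₁| * |γ q₂| *
          ∑ n₁ ∈ dyadic N, ∑ n₂ ∈ dyadic N,
            (if ¬(Squarefree n₁ ∧ Squarefree n₂) then |β n₁ * β n₂| * tauDiff n₁ n₂ else 0) := by
        refine mul_le_mul_of_nonneg_left (Finset.sum_le_sum fun q₁ _ => Finset.sum_le_sum fun q₂ _ =>
          mul_le_mul_of_nonneg_left (Finset.sum_le_sum fun n₁ _ => Finset.sum_le_sum fun n₂ _ =>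
            hWcount n₁ n₂) (by positivity)) hc0
    _ = c * ((∑ q ∈ dyadic Q, |γ q|) ^ 2 * ∑ n₁ ∈ dyadic N, ∑ n₂ ∈ dyadic N,
            (if ¬(Squarefree n₁ ∧ Squarefree n₂) then |β n₁ * β n₂| * tauDiff n₁ n₂ else 0)) := by
        rw [sq, Finset.sum_mul_sum, Finset.sum_mul]
        refine congrArg _ (Finset.sum_congr rfl fun q₁ _ => ?_)
        rw [Finset.sum_mul]
    _ ≤ c * ((∑ q ∈ dyadic Q, |γ q|) ^ 2 * (2 * l2Sq N β * Real.sqrt (T₁ * Real.sqrt (Nn * T₂)))) := by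
        gcongr
        exact nsf_pair_weight_le β hT₁0 hT₂0 hT₁ hT₂ hNn
    _ = _ := by ring


/-! ## The non-squarefree pairs in `𝒮₁ᶜ` (BFI (6.8): "Due to (A₄) the terms in `𝒮₁*` with `n₁n₂`
not squarefree can be removed with admissible error as in (6.4)") -/

/-- The exceptional support: `Bad = {n ∼ N : μ²(n) = 0, β_n ≠ 0}`. [folklore] -/
def badSet (N : ℝ) (β : ℕ → ℝ) : Finset ℕ := (dyadic N).filter (fun n => ¬Squarefree n ∧ β n ≠ 0)

/-- Membership in `Bad`. [folklore] -/
theorem mem_badSet {N : ℝ} {β : ℕ → ℝ} {n : ℕ} :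
    n ∈ badSet N β ↔ n ∈ dyadic N ∧ ¬Squarefree n ∧ β n ≠ 0 := by
  unfold badSet; rw [Finset.mem_filter]

/-- `Bad ⊆ (N, 2N]`. [folklore] -/
theorem badSet_subset (N : ℝ) (β : ℕ → ℝ) : badSet N β ⊆ dyadic N := Finset.filter_subset _ _

/-- **Transfer of a weighted `m`-sum in a progression to Lemma 3** (the variable `v = m n`):
for `0 < Y ≤ M`, `|a| < M − Y`, `n ≥ 1`, `k ≥ 1`, `A ≥ 0` and a class `c (mod k)`,
`∑_{m ∈ mRange, m ≡ c (k)} f(m) τ(mn − a)^A ≤ ∑_{v ∈ l3Set((2M+Y)n, kn, c̃ n)} τ(v)^A τ(v−a)^A`.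
[folklore] -/
theorem sum_mRange_class_bump_rpow_sigma_sub_le_l3 {a : ℤ} {A : ℝ} (hA : 0 ≤ A) {M Y : ℝ}
    (hY : 0 < Y) (hYM : Y ≤ M) (haM : (|a| : ℝ) < M - Y) {k n : ℕ} (hk : 0 < k) (hn : 0 < n)
    (c : ZMod k) :
    ∑ m ∈ (mRange M Y).filter (fun m : ℕ => (m : ZMod k) = c),
        bump M Y m * (σ 0 (((m * n : ℕ) : ℤ) - a).toNat : ℝ) ^ A ≤
      ∑ v ∈ l3Set a ((2 * M + Y) * n) (k * n) ((c.val * n : ℕ) : ZMod (k * n)), l3Term a A v := by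
  have hM : 0 ≤ M := hY.le.trans hYM
  haveI : NeZero k := ⟨hk.ne'⟩
  set S₀ := ((mRange M Y).filter (fun m : ℕ => (m : ZMod k) = c)).filter (fun m : ℕ => bump M Y m ≠ 0)
    with hS₀
  -- members of `S₀` are `> M - Y > |a|`
  have hmem : ∀ m ∈ S₀, (M - Y < (m : ℝ)) ∧ (m : ℝ) ≤ 2 * M + Y ∧ (m : ZMod k) = c := by
    intro m hm
    rw [hS₀, Finset.mem_filter, Finset.mem_filter, mem_mRange] at hm
    obtain ⟨⟨hmr, hml⟩, hb⟩ := hm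
    refine ⟨?_, ?_, hml⟩
    · by_contra h
      exact hb (bump_eq_zero_of_le hY hM (not_lt.1 h))
    · have := Nat.floor_le (show 0 ≤ 2 * M + Y by linarith)
      exact le_trans (by exact_mod_cast hmr) this
  have hinj : Set.InjOn (fun m : ℕ => m * n) (S₀ : Set ℕ) := fun m₁ _ m₂ _ h =>
    Nat.eq_of_mul_eq_mul_right hn h
  have himg : S₀.image (fun m => m * n) ⊆
      l3Set a ((2 * M + Y) * n) (k * n) ((c.val * n : ℕ) : ZMod (k * n)) := by
    intro v hv
    rw [Finset.mem_image] at hv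
    obtain ⟨m, hm, rfl⟩ := hv
    obtain ⟨hm1, hm2, hmc⟩ := hmem m hm
    have hm0 : (0 : ℝ) < m := by linarith [abs_nonneg (a : ℝ)]
    unfold l3Set
    rw [Finset.mem_filter, Finset.mem_Icc]
    refine ⟨⟨?_, ?_⟩, ?_, ?_⟩
    · have : 0 < m := by exact_mod_cast hm0
      exact Nat.mul_pos this hn
    · refine Nat.le_floor ?_; push_cast
      exact mul_le_mul_of_nonneg_right hm2 (by positivity)
    · have h1 : (|a| : ℝ) < m := by linarith
      have h2 : (m : ℝ) ≤ (m : ℝ) * n := le_mul_of_one_le_right hm0.le (by exact_mod_cast hn)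
      have : (|a| : ℝ) < (m * n : ℕ) := by push_cast; linarith
      have : ((|a| : ℤ) : ℝ) < (((m * n : ℕ) : ℤ) : ℝ) := by push_cast; linarith
      exact_mod_cast this
    · -- the class of `m n` modulo `k n`
      have hmk : m % k = c.val := by
        have := (ZMod.natCast_eq_natCast_iff' m c.val k).1 (by rw [ZMod.natCast_val, ZMod.cast_id', id]; exact hmc)
        rw [this, Nat.mod_eq_of_lt (ZMod.val_lt c)]
      rw [ZMod.natCast_eq_natCast_iff']
      rw [Nat.mul_mod_mul_right, hmk]
      symm; apply Nat.mod_eq_of_lt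
      exact Nat.mul_lt_mul_of_pos_right (ZMod.val_lt c) hn
  calc ∑ m ∈ (mRange M Y).filter (fun m : ℕ => (m : ZMod k) = c),
          bump M Y m * (σ 0 (((m * n : ℕ) : ℤ) - a).toNat : ℝ) ^ A
      = ∑ m ∈ S₀, bump M Y m * (σ 0 (((m * n : ℕ) : ℤ) - a).toNat : ℝ) ^ A := by
        rw [hS₀]; symm
        refine Finset.sum_filter_of_ne fun m _ hne => fun h => hne (by rw [h, zero_mul])
    _ ≤ ∑ m ∈ S₀, l3Term a A (m * n) := by
        refine Finset.sum_le_sum fun m hm => ?_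
        obtain ⟨hm1, _, _⟩ := hmem m hm
        have hm0 : 0 < m := by
          have : (0 : ℝ) < m := by linarith [abs_nonneg (a : ℝ)]
          exact_mod_cast this
        have h1 : bump M Y m ≤ 1 := (bump_mem_Icc hY hM _).2
        have h0 : 0 ≤ bump M Y m := (bump_mem_Icc hY hM _).1
        have h3 : 0 ≤ (σ 0 (((m * n : ℕ) : ℤ) - a).toNat : ℝ) ^ A := by positivity
        calc bump M Y m * (σ 0 (((m * n : ℕ) : ℤ) - a).toNat : ℝ) ^ A
            ≤ 1 * (σ 0 (((m * n : ℕ) : ℤ) - a).toNat : ℝ) ^ A := mul_le_mul_of_nonneg_right h1 h3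
          _ ≤ l3Term a A (m * n) := by
              rw [one_mul]; exact rpow_sigma_sub_le_l3Term hA (Nat.mul_pos hm0 hn)
    _ = ∑ v ∈ S₀.image (fun m => m * n), l3Term a A v := (Finset.sum_image hinj).symm
    _ ≤ _ := Finset.sum_le_sum_of_subset_of_nonneg himg fun v _ _ => l3Term_nonneg a A v


/-- The one-sided majorant of the non-squarefree part of `𝒮₁ᶜ`:
`V = ∑_{r,q₁,q₂,n₁,n₂} [Main] [n₁ ∈ Bad] |γ_{q₁}γ_{q₂}β_{n₁}β_{n₂}| A₁`. [folklore] -/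
def vBad (a : ℤ) (S : Finset ℕ) (N Q R Q₀ : ℝ) (w β γ : ℕ → ℝ) : ℝ :=
  ∑ r ∈ dyadic R, ∑ q₁ ∈ dyadic Q, ∑ q₂ ∈ dyadic Q, ∑ n₁ ∈ dyadic N, ∑ n₂ ∈ dyadic N,
    if Main Q₀ q₁ q₂ n₁ n₂ ∧ n₁ ∈ badSet N β then
      |γ q₁| * |γ q₂| * |β n₁| * |β n₂| * mA1 a S w r q₁ q₂ n₁ n₂ else 0

/-- The swap symmetry `(q₁,n₁) ↔ (q₂,n₂)` of a `Main`-restricted sum with the weight `A₁`. [folklore] -/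
theorem sum_main_swap (a : ℤ) (S : Finset ℕ) (N Q Q₀ : ℝ) (w : ℕ → ℝ) (r : ℕ)
    (F : ℕ → ℕ → ℕ → ℕ → ℝ) :
    ∑ q₁ ∈ dyadic Q, ∑ q₂ ∈ dyadic Q, ∑ n₁ ∈ dyadic N, ∑ n₂ ∈ dyadic N,
      (if Main Q₀ q₁ q₂ n₁ n₂ then F q₁ q₂ n₁ n₂ * mA1 a S w r q₁ q₂ n₁ n₂ else 0) =
    ∑ q₁ ∈ dyadic Q, ∑ q₂ ∈ dyadic Q, ∑ n₁ ∈ dyadic N, ∑ n₂ ∈ dyadic N,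
      (if Main Q₀ q₁ q₂ n₁ n₂ then F q₂ q₁ n₂ n₁ * mA1 a S w r q₁ q₂ n₁ n₂ else 0) := by
  rw [Finset.sum_comm]
  refine Finset.sum_congr rfl fun q₁ _ => Finset.sum_congr rfl fun q₂ _ => ?_
  rw [Finset.sum_comm]
  refine Finset.sum_congr rfl fun n₁ _ => Finset.sum_congr rfl fun n₂ _ => ?_
  rw [mA1_swap]
  by_cases h : Main Q₀ q₂ q₁ n₂ n₁
  · rw [if_pos h, if_pos ((main_swap Q₀ q₂ q₁ n₂ n₁).1 h)]
  · rw [if_neg h, if_neg (fun h' => h ((main_swap Q₀ q₂ q₁ n₂ n₁).2 h'))]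

/-- **Step 1**: `|𝒮₁ᶜ(β) − 𝒮₁ᶜ(β♭)| ≤ 2V` (`w ≥ 0`): a term with `n₁n₂` not squarefree and
`β_{n₁}β_{n₂} ≠ 0` has `n₁ ∈ Bad` or `n₂ ∈ Bad`, and the two halves agree by the swap symmetry.
[cite: BombieriFriedlanderIwaniecActa1986, §6 (6.8) p. 220] -/
theorem abs_dS1c_sub_sqfPart_le_two_mul_vBad (a : ℤ) {S : Finset ℕ} (N Q R Q₀ : ℝ) {w : ℕ → ℝ}
    (hw : ∀ m ∈ S, 0 ≤ w m) (β γ : ℕ → ℝ) :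
    |dS1c a S N Q R Q₀ w β γ - dS1c a S N Q R Q₀ w (sqfPart β) γ| ≤ 2 * vBad a S N Q R Q₀ w β γ := by
  classical
  have hA0 : ∀ r q₁ q₂ n₁ n₂, 0 ≤ mA1 a S w r q₁ q₂ n₁ n₂ := fun r q₁ q₂ n₁ n₂ =>
    (mA1_nonneg_le hw r q₁ q₂ n₁ n₂).1
  -- pointwise
  have hpt : ∀ r q₁ q₂, ∀ n₁ ∈ dyadic N, ∀ n₂ ∈ dyadic N,
      |(if Main Q₀ q₁ q₂ n₁ n₂ then γ q₁ * γ q₂ * β n₁ * β n₂ * mA1 a S w r q₁ q₂ n₁ n₂ else 0) -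
        (if Main Q₀ q₁ q₂ n₁ n₂ then
          γ q₁ * γ q₂ * sqfPart β n₁ * sqfPart β n₂ * mA1 a S w r q₁ q₂ n₁ n₂ else 0)| ≤
      (if Main Q₀ q₁ q₂ n₁ n₂ ∧ n₁ ∈ badSet N β then
          |γ q₁| * |γ q₂| * |β n₁| * |β n₂| * mA1 a S w r q₁ q₂ n₁ n₂ else 0) +
      (if Main Q₀ q₁ q₂ n₁ n₂ then (if n₂ ∈ badSet N β then
          |γ q₂| * |γ q₁| * |β n₂| * |β n₁| else 0) * mA1 a S w r q₁ q₂ n₁ n₂ else 0) := by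
    intro r q₁ q₂ n₁ hn₁ n₂ hn₂
    have hnn : 0 ≤ |γ q₁| * |γ q₂| * |β n₁| * |β n₂| * mA1 a S w r q₁ q₂ n₁ n₂ := by
      have := hA0 r q₁ q₂ n₁ n₂; positivity
    have ha : 0 ≤ (if Main Q₀ q₁ q₂ n₁ n₂ ∧ n₁ ∈ badSet N β then
        |γ q₁| * |γ q₂| * |β n₁| * |β n₂| * mA1 a S w r q₁ q₂ n₁ n₂ else 0) := by
      split_ifs; exact hnn; exact le_rfl
    have hb : 0 ≤ (if Main Q₀ q₁ q₂ n₁ n₂ then (if n₂ ∈ badSet N β then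
        |γ q₂| * |γ q₁| * |β n₂| * |β n₁| else 0) * mA1 a S w r q₁ q₂ n₁ n₂ else 0) := by
      split_ifs
      · have : |γ q₂| * |γ q₁| * |β n₂| * |β n₁| * mA1 a S w r q₁ q₂ n₁ n₂ =
            |γ q₁| * |γ q₂| * |β n₁| * |β n₂| * mA1 a S w r q₁ q₂ n₁ n₂ := by ring
        rw [this]; exact hnn
      · rw [zero_mul]
      · exact le_rfl
    by_cases hM : Main Q₀ q₁ q₂ n₁ n₂
    · simp only [if_pos hM] at ha hb ⊢
      by_cases hsq : Squarefree n₁ ∧ Squarefree n₂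
      · have e : sqfPart β n₁ = β n₁ ∧ sqfPart β n₂ = β n₂ := by
          unfold sqfPart; exact ⟨if_pos hsq.1, if_pos hsq.2⟩
        rw [e.1, e.2, sub_self, abs_zero]
        exact add_nonneg ha hb
      · have e : sqfPart β n₁ * sqfPart β n₂ = 0 := by
          unfold sqfPart
          rcases not_and_or.1 hsq with h | h
          · rw [if_neg h, zero_mul]
          · rw [if_neg h, mul_zero]
        rw [mul_assoc (γ q₁ * γ q₂) (sqfPart β n₁), e, mul_zero, zero_mul, sub_zero]
        by_cases hz : β n₁ * β n₂ = 0
        · have : γ q₁ * γ q₂ * β n₁ * β n₂ * mA1 a S w r q₁ q₂ n₁ n₂ = 0 := by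
            rw [mul_assoc (γ q₁ * γ q₂) (β n₁), hz]; ring
          rw [this, abs_zero]
          exact add_nonneg ha hb
        have hb1 : β n₁ ≠ 0 := fun h => hz (by rw [h, zero_mul])
        have hb2 : β n₂ ≠ 0 := fun h => hz (by rw [h, mul_zero])
        have habs : |γ q₁ * γ q₂ * β n₁ * β n₂ * mA1 a S w r q₁ q₂ n₁ n₂| =
            |γ q₁| * |γ q₂| * |β n₁| * |β n₂| * mA1 a S w r q₁ q₂ n₁ n₂ := by
          rw [abs_mul, abs_mul, abs_mul, abs_mul, abs_of_nonneg (hA0 _ _ _ _ _)]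
        rw [habs]
        rcases not_and_or.1 hsq with h | h
        · have hmem : n₁ ∈ badSet N β := mem_badSet.2 ⟨hn₁, h, hb1⟩
          rw [if_pos ⟨hM, hmem⟩]; linarith [hb]
        · have hmem : n₂ ∈ badSet N β := mem_badSet.2 ⟨hn₂, h, hb2⟩
          rw [if_pos hmem]
          have : |γ q₂| * |γ q₁| * |β n₂| * |β n₁| * mA1 a S w r q₁ q₂ n₁ n₂ =
              |γ q₁| * |γ q₂| * |β n₁| * |β n₂| * mA1 a S w r q₁ q₂ n₁ n₂ := by ring
          rw [this]; linarith [ha]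
    · simp only [if_neg hM, sub_self, abs_zero]
      rw [if_neg (fun h => hM h.1)]; simp
  -- sum
  unfold dS1c vBad
  simp only [← Finset.sum_sub_distrib]
  refine (Finset.abs_sum_le_sum_abs _ _).trans ?_
  rw [two_mul, ← Finset.sum_add_distrib]
  refine Finset.sum_le_sum fun r _ => ?_
  -- second copy via the swap
  have hswap := sum_main_swap a S N Q Q₀ w r
    (fun q₁ q₂ n₁ n₂ => if n₁ ∈ badSet N β then |γ q₁| * |γ q₂| * |β n₁| * |β n₂| else 0)
  have hV : ∑ q₁ ∈ dyadic Q, ∑ q₂ ∈ dyadic Q, ∑ n₁ ∈ dyadic N, ∑ n₂ ∈ dyadic N,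
      (if Main Q₀ q₁ q₂ n₁ n₂ ∧ n₁ ∈ badSet N β then
        |γ q₁| * |γ q₂| * |β n₁| * |β n₂| * mA1 a S w r q₁ q₂ n₁ n₂ else 0) =
      ∑ q₁ ∈ dyadic Q, ∑ q₂ ∈ dyadic Q, ∑ n₁ ∈ dyadic N, ∑ n₂ ∈ dyadic N,
      (if Main Q₀ q₁ q₂ n₁ n₂ then (if n₁ ∈ badSet N β then
          |γ q₁| * |γ q₂| * |β n₁| * |β n₂| else 0) * mA1 a S w r q₁ q₂ n₁ n₂ else 0) := by
    refine Finset.sum_congr rfl fun q₁ _ => Finset.sum_congr rfl fun q₂ _ =>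
      Finset.sum_congr rfl fun n₁ _ => Finset.sum_congr rfl fun n₂ _ => ?_
    by_cases hM : Main Q₀ q₁ q₂ n₁ n₂
    · by_cases hb : n₁ ∈ badSet N β
      · rw [if_pos ⟨hM, hb⟩, if_pos hM, if_pos hb]
      · rw [if_neg (fun h => hb h.2), if_pos hM, if_neg hb, zero_mul]
    · rw [if_neg (fun h => hM h.1), if_neg hM]
  calc _ ≤ ∑ q₁ ∈ dyadic Q, |∑ q₂ ∈ dyadic Q, ∑ n₁ ∈ dyadic N, ∑ n₂ ∈ dyadic N, _| :=
        Finset.abs_sum_le_sum_abs _ _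
    _ ≤ ∑ q₁ ∈ dyadic Q, ∑ q₂ ∈ dyadic Q, ∑ n₁ ∈ dyadic N, ∑ n₂ ∈ dyadic N,
        ((if Main Q₀ q₁ q₂ n₁ n₂ ∧ n₁ ∈ badSet N β then
          |γ q₁| * |γ q₂| * |β n₁| * |β n₂| * mA1 a S w r q₁ q₂ n₁ n₂ else 0) +
        (if Main Q₀ q₁ q₂ n₁ n₂ then (if n₂ ∈ badSet N β then
          |γ q₂| * |γ q₁| * |β n₂| * |β n₁| else 0) * mA1 a S w r q₁ q₂ n₁ n₂ else 0)) := by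
        refine Finset.sum_le_sum fun q₁ _ => (Finset.abs_sum_le_sum_abs _ _).trans
          (Finset.sum_le_sum fun q₂ _ => (Finset.abs_sum_le_sum_abs _ _).trans
          (Finset.sum_le_sum fun n₁ hn₁ => (Finset.abs_sum_le_sum_abs _ _).trans
          (Finset.sum_le_sum fun n₂ hn₂ => hpt r q₁ q₂ n₁ hn₁ n₂ hn₂)))
    _ = _ := by
        simp only [Finset.sum_add_distrib]
        rw [hV, ← hswap]


/-- **Step 2** (Cauchy's inequality in the weighted form `|β₁β₂| ≤ (θβ₂² + β₁²/θ)/2`, the swap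
symmetry, and `A₁ ≤ B`): for every `θ > 0`,
`V ≤ (θ/2) restSum[Main ∧ n₂ ∈ Bad] + (1/(2θ)) restSum[Main]`.
[cite: BombieriFriedlanderIwaniecActa1986, §6 (6.4) p. 220] -/
theorem vBad_le (a : ℤ) {S : Finset ℕ} (N Q R Q₀ : ℝ) {w : ℕ → ℝ} (hw : ∀ m ∈ S, 0 ≤ w m)
    (β γ : ℕ → ℝ) {θ : ℝ} (hθ : 0 < θ) :
    vBad a S N Q R Q₀ w β γ ≤
      θ / 2 * restSum a S N Q R w β γ (fun q₁ q₂ n₁ n₂ => Main Q₀ q₁ q₂ n₁ n₂ ∧ n₂ ∈ badSet N β) +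
        1 / (2 * θ) * restSum a S N Q R w β γ (fun q₁ q₂ n₁ n₂ => Main Q₀ q₁ q₂ n₁ n₂) := by
  classical
  have hA : ∀ r q₁ q₂ n₁ n₂, 0 ≤ mA1 a S w r q₁ q₂ n₁ n₂ ∧
      mA1 a S w r q₁ q₂ n₁ n₂ ≤ mB a S w r q₁ q₂ n₁ n₂ := fun r q₁ q₂ n₁ n₂ => mA1_le_mB hw r q₁ q₂ n₁ n₂
  unfold vBad restSum
  rw [Finset.mul_sum, Finset.mul_sum, ← Finset.sum_add_distrib]
  refine Finset.sum_le_sum fun r _ => ?_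
  -- pointwise AM-GM
  have hpt : ∀ q₁ q₂ n₁ n₂,
      (if Main Q₀ q₁ q₂ n₁ n₂ ∧ n₁ ∈ badSet N β then
        |γ q₁| * |γ q₂| * |β n₁| * |β n₂| * mA1 a S w r q₁ q₂ n₁ n₂ else 0) ≤
      θ / 2 * (if Main Q₀ q₁ q₂ n₁ n₂ then (if n₁ ∈ badSet N β then |γ q₁| * |γ q₂| * β n₂ ^ 2 else 0) *
          mA1 a S w r q₁ q₂ n₁ n₂ else 0) +
      1 / (2 * θ) * (if Main Q₀ q₁ q₂ n₁ n₂ then |γ q₁| * |γ q₂| * β n₁ ^ 2 * mA1 a S w r q₁ q₂ n₁ n₂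
          else 0) := by
    intro q₁ q₂ n₁ n₂
    have hA0 := (hA r q₁ q₂ n₁ n₂).1
    by_cases hM : Main Q₀ q₁ q₂ n₁ n₂
    · simp only [if_pos hM]
      by_cases hb : n₁ ∈ badSet N β
      · rw [if_pos ⟨hM, hb⟩, if_pos hb]
        have key : |β n₁| * |β n₂| ≤ (θ * β n₂ ^ 2 + β n₁ ^ 2 / θ) / 2 := by
          have h1 : 0 ≤ (θ * |β n₂| - |β n₁|) ^ 2 / θ := by positivity
          have e : (θ * |β n₂| - |β n₁|) ^ 2 / θ = θ * β n₂ ^ 2 + β n₁ ^ 2 / θ - 2 * (|β n₁| * |β n₂|) := by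
            field_simp
            rw [← sq_abs (β n₁), ← sq_abs (β n₂)]; ring
          linarith [e ▸ h1]
        have hg : 0 ≤ |γ q₁| * |γ q₂| * mA1 a S w r q₁ q₂ n₁ n₂ := by positivity
        calc |γ q₁| * |γ q₂| * |β n₁| * |β n₂| * mA1 a S w r q₁ q₂ n₁ n₂
            = (|γ q₁| * |γ q₂| * mA1 a S w r q₁ q₂ n₁ n₂) * (|β n₁| * |β n₂|) := by ring
          _ ≤ (|γ q₁| * |γ q₂| * mA1 a S w r q₁ q₂ n₁ n₂) * ((θ * β n₂ ^ 2 + β n₁ ^ 2 / θ) / 2) :=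
              mul_le_mul_of_nonneg_left key hg
          _ = _ := by field_simp
      · rw [if_neg (fun h => hb h.2), if_neg hb, zero_mul, mul_zero, zero_add]
        positivity
    · rw [if_neg (fun h => hM h.1), if_neg hM, if_neg hM]; simp
  -- sum and identify
  calc ∑ q₁ ∈ dyadic Q, ∑ q₂ ∈ dyadic Q, ∑ n₁ ∈ dyadic N, ∑ n₂ ∈ dyadic N,
        (if Main Q₀ q₁ q₂ n₁ n₂ ∧ n₁ ∈ badSet N β then
          |γ q₁| * |γ q₂| * |β n₁| * |β n₂| * mA1 a S w r q₁ q₂ n₁ n₂ else 0)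
      ≤ ∑ q₁ ∈ dyadic Q, ∑ q₂ ∈ dyadic Q, ∑ n₁ ∈ dyadic N, ∑ n₂ ∈ dyadic N,
        (θ / 2 * (if Main Q₀ q₁ q₂ n₁ n₂ then (if n₁ ∈ badSet N β then |γ q₁| * |γ q₂| * β n₂ ^ 2 else 0) *
          mA1 a S w r q₁ q₂ n₁ n₂ else 0) +
        1 / (2 * θ) * (if Main Q₀ q₁ q₂ n₁ n₂ then |γ q₁| * |γ q₂| * β n₁ ^ 2 * mA1 a S w r q₁ q₂ n₁ n₂
          else 0)) :=
        Finset.sum_le_sum fun q₁ _ => Finset.sum_le_sum fun q₂ _ => Finset.sum_le_sum fun n₁ _ =>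
          Finset.sum_le_sum fun n₂ _ => hpt q₁ q₂ n₁ n₂
    _ = θ / 2 * ∑ q₁ ∈ dyadic Q, ∑ q₂ ∈ dyadic Q, ∑ n₁ ∈ dyadic N, ∑ n₂ ∈ dyadic N,
          (if Main Q₀ q₁ q₂ n₁ n₂ then (if n₁ ∈ badSet N β then |γ q₁| * |γ q₂| * β n₂ ^ 2 else 0) *
            mA1 a S w r q₁ q₂ n₁ n₂ else 0) +
        1 / (2 * θ) * ∑ q₁ ∈ dyadic Q, ∑ q₂ ∈ dyadic Q, ∑ n₁ ∈ dyadic N, ∑ n₂ ∈ dyadic N,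
          (if Main Q₀ q₁ q₂ n₁ n₂ then |γ q₁| * |γ q₂| * β n₁ ^ 2 * mA1 a S w r q₁ q₂ n₁ n₂ else 0) := by
        simp only [Finset.sum_add_distrib, Finset.mul_sum]
    _ = θ / 2 * ∑ q₁ ∈ dyadic Q, ∑ q₂ ∈ dyadic Q, ∑ n₁ ∈ dyadic N, ∑ n₂ ∈ dyadic N,
          (if Main Q₀ q₁ q₂ n₁ n₂ then (if n₂ ∈ badSet N β then |γ q₂| * |γ q₁| * β n₁ ^ 2 else 0) *
            mA1 a S w r q₁ q₂ n₁ n₂ else 0) +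
        1 / (2 * θ) * ∑ q₁ ∈ dyadic Q, ∑ q₂ ∈ dyadic Q, ∑ n₁ ∈ dyadic N, ∑ n₂ ∈ dyadic N,
          (if Main Q₀ q₁ q₂ n₁ n₂ then |γ q₁| * |γ q₂| * β n₁ ^ 2 * mA1 a S w r q₁ q₂ n₁ n₂ else 0) := by
        rw [sum_main_swap a S N Q Q₀ w r
          (fun q₁ q₂ n₁ n₂ => if n₁ ∈ badSet N β then |γ q₁| * |γ q₂| * β n₂ ^ 2 else 0)]
    _ ≤ _ := by
        have h1 : ∀ q₁ q₂ n₁ n₂,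
            (if Main Q₀ q₁ q₂ n₁ n₂ then (if n₂ ∈ badSet N β then |γ q₂| * |γ q₁| * β n₁ ^ 2 else 0) *
              mA1 a S w r q₁ q₂ n₁ n₂ else 0) ≤
            (if Main Q₀ q₁ q₂ n₁ n₂ ∧ n₂ ∈ badSet N β then
              |γ q₁| * |γ q₂| * β n₁ ^ 2 * mB a S w r q₁ q₂ n₁ n₂ else 0) := by
          intro q₁ q₂ n₁ n₂
          obtain ⟨hA0, hAB⟩ := hA r q₁ q₂ n₁ n₂
          by_cases hM : Main Q₀ q₁ q₂ n₁ n₂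
          · simp only [if_pos hM]
            by_cases hb : n₂ ∈ badSet N β
            · rw [if_pos hb, if_pos ⟨hM, hb⟩]
              have : |γ q₂| * |γ q₁| * β n₁ ^ 2 = |γ q₁| * |γ q₂| * β n₁ ^ 2 := by ring
              rw [this]
              exact mul_le_mul_of_nonneg_left hAB (by positivity)
            · rw [if_neg hb, if_neg (fun h => hb h.2), zero_mul]
          · rw [if_neg hM, if_neg (fun h => hM h.1)]
        have h2 : ∀ q₁ q₂ n₁ n₂,
            (if Main Q₀ q₁ q₂ n₁ n₂ then |γ q₁| * |γ q₂| * β n₁ ^ 2 * mA1 a S w r q₁ q₂ n₁ n₂ else 0) ≤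
            (if Main Q₀ q₁ q₂ n₁ n₂ then |γ q₁| * |γ q₂| * β n₁ ^ 2 * mB a S w r q₁ q₂ n₁ n₂ else 0) := by
          intro q₁ q₂ n₁ n₂
          obtain ⟨hA0, hAB⟩ := hA r q₁ q₂ n₁ n₂
          split_ifs
          · exact mul_le_mul_of_nonneg_left hAB (by positivity)
          · exact le_rfl
        have hθ2 : 0 ≤ θ / 2 := by positivity
        have hθ3 : 0 ≤ 1 / (2 * θ) := by positivity
        refine add_le_add (mul_le_mul_of_nonneg_left ?_ hθ2) (mul_le_mul_of_nonneg_left ?_ hθ3)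
        · exact Finset.sum_le_sum fun q₁ _ => Finset.sum_le_sum fun q₂ _ =>
            Finset.sum_le_sum fun n₁ _ => Finset.sum_le_sum fun n₂ _ => h1 q₁ q₂ n₁ n₂
        · exact Finset.sum_le_sum fun q₁ _ => Finset.sum_le_sum fun q₂ _ =>
            Finset.sum_le_sum fun n₁ _ => Finset.sum_le_sum fun n₂ _ => h2 q₁ q₂ n₁ n₂


/-- The shifted value `v = mn − a` (a natural number when `mn > |a|`). [folklore] -/
def vSh (a : ℤ) (m n : ℕ) : ℕ := (((m * n : ℕ) : ℤ) - a).toNat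

/-- `v = mn − a` as an integer (`mn > |a|`). [folklore] -/
theorem vSh_cast {a : ℤ} {m n : ℕ} (h : |a| < ((m * n : ℕ) : ℤ)) : (vSh a m n : ℤ) = ((m * n : ℕ) : ℤ) - a := by
  unfold vSh; have := lt_of_le_of_lt (le_abs_self a) h; omega

/-- `v = mn − a ≥ 1` (`mn > |a|`). [folklore] -/
theorem vSh_pos {a : ℤ} {m n : ℕ} (h : |a| < ((m * n : ℕ) : ℤ)) : 0 < vSh a m n := by
  have := vSh_cast h; have h2 := lt_of_le_of_lt (le_abs_self a) h; omega

/-- **The inner `(q₂, n₂)`-sum against a set `T` of admissible `n₂`**: if `P(q₁,q₂,n₁,n₂)` forces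
`n₂ ∈ T` and `n₂ ≠ n₁`, then for `(q₁r, a) = 1`, `mn₁ ≡ a (q₁r)`, `|γ_q| ≤ τ(q)^B` and `|a| < mn`
on `n ∼ N`,
`innerP[P](m,r,q₁,n₁) ≤ ∑_{n₂ ∈ T, n₂ ≠ n₁, r ∣ |n₁−n₂|} τ(mn₂ − a)^{B+1}`
(the `q₂ ∼ Q` with `q₂r ∣ mn₂ − a` number at most `τ(mn₂−a)` weighted, and `r ∣ mn₂ − a`,
`r ∣ mn₁ − a`, `(m,r)=1` give `r ∣ n₁ − n₂`). [cite: BombieriFriedlanderIwaniecActa1986, §6 (6.3)–(6.4) p. 220] -/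
theorem innerP_le_sum_filter {a : ℤ} {N Q B : ℝ} (hB : 0 ≤ B) {γ : ℕ → ℝ}
    (hγ : ∀ q, |γ q| ≤ (σ 0 q : ℝ) ^ B) (P : ℕ → ℕ → ℕ → ℕ → Prop)
    [∀ q₁ q₂ n₁ n₂, Decidable (P q₁ q₂ n₁ n₂)] {T : Finset ℕ} {m r q₁ n₁ : ℕ} (hr : 0 < r)
    (hq₁ : 0 < q₁) (hPT : ∀ q₂ n₂, n₂ ∈ dyadic N → P q₁ q₂ n₁ n₂ → n₂ ∈ T ∧ n₂ ≠ n₁)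
    (hTN : T ⊆ dyadic N)
    (hcop : IsCoprime ((q₁ * r : ℕ) : ℤ) a)
    (hc : ((m * n₁ : ℕ) : ZMod (q₁ * r)) = (a : ZMod (q₁ * r)))
    (ha : ∀ n ∈ dyadic N, |a| < ((m * n : ℕ) : ℤ)) :
    innerP a N Q γ P m r q₁ n₁ ≤
      ∑ n₂ ∈ T.filter (fun n₂ => n₂ ≠ n₁ ∧ r ∣ Int.natAbs ((n₁ : ℤ) - n₂)),
        (σ 0 (vSh a m n₂) : ℝ) ^ (B + 1) := by
  classical
  have hk : 0 < q₁ * r := Nat.mul_pos hq₁ hr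
  obtain ⟨hmk, _⟩ := coprime_of_mul_congr hk hcop hc
  have hmr : m.Coprime r := Nat.Coprime.coprime_dvd_right (dvd_mul_left r q₁) hmk
  -- `r ∣ m n₁ - a`
  have hr₁ : (r : ℤ) ∣ ((m * n₁ : ℕ) : ℤ) - a := by
    have h' : (((m * n₁ : ℕ) : ℤ) : ZMod (q₁ * r)) = ((a : ℤ) : ZMod (q₁ * r)) := by exact_mod_cast hc
    rw [ZMod.intCast_eq_intCast_iff_dvd_sub] at h'
    have h2 : ((q₁ * r : ℕ) : ℤ) ∣ ((m * n₁ : ℕ) : ℤ) - a := by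
      have := h'.neg_right; rwa [neg_sub] at this
    exact dvd_trans (by push_cast; exact dvd_mul_left _ _) h2
  unfold innerP
  rw [Finset.sum_comm]
  -- compare with the sum over `dyadic N` of the filtered indicator
  calc ∑ n₂ ∈ dyadic N, ∑ q₂ ∈ dyadic Q,
        (if P q₁ q₂ n₁ n₂ ∧ ((m * n₂ : ℕ) : ZMod (q₂ * r)) = (a : ZMod (q₂ * r)) then |γ q₂| else 0)
      ≤ ∑ n₂ ∈ dyadic N, (if n₂ ∈ T ∧ n₂ ≠ n₁ ∧ r ∣ Int.natAbs ((n₁ : ℤ) - n₂) then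
          (σ 0 (vSh a m n₂) : ℝ) ^ (B + 1) else 0) := by
        refine Finset.sum_le_sum fun n₂ hn₂ => ?_
        have hv : a < ((m * n₂ : ℕ) : ℤ) := lt_of_le_of_lt (le_abs_self a) (ha n₂ hn₂)
        have hS := sum_dyadic_cong_abs_le (Q := Q) (r := r) hB hγ hv
        by_cases hP : ∃ q₂ ∈ dyadic Q, P q₁ q₂ n₁ n₂ ∧ ((m * n₂ : ℕ) : ZMod (q₂ * r)) = (a : ZMod (q₂ * r))
        · obtain ⟨q₂, hq₂, hPq, hcq⟩ := hP
          obtain ⟨hT, hne⟩ := hPT q₂ n₂ hn₂ hPq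
          -- `r ∣ v(n₂)` from the congruence modulo `q₂ r`
          have hr₂ : (r : ℤ) ∣ ((m * n₂ : ℕ) : ℤ) - a := by
            have h' : (((m * n₂ : ℕ) : ℤ) : ZMod (q₂ * r)) = ((a : ℤ) : ZMod (q₂ * r)) := by
              exact_mod_cast hcq
            rw [ZMod.intCast_eq_intCast_iff_dvd_sub] at h'
            have h2 : ((q₂ * r : ℕ) : ℤ) ∣ ((m * n₂ : ℕ) : ℤ) - a := by
              have := h'.neg_right; rwa [neg_sub] at this
            exact dvd_trans (by push_cast; exact dvd_mul_left _ _) h2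
          have hrd : r ∣ Int.natAbs ((n₁ : ℤ) - n₂) := by
            have e3 : (r : ℤ) ∣ (m : ℤ) * ((n₁ : ℤ) - n₂) := by
              have := Int.dvd_sub hr₁ hr₂
              have e : ((m * n₁ : ℕ) : ℤ) - a - (((m * n₂ : ℕ) : ℤ) - a) = (m : ℤ) * ((n₁ : ℤ) - n₂) := by
                push_cast; ring
              rwa [e] at this
            have h3 : (r : ℤ) ∣ (n₁ : ℤ) - n₂ :=
              (Nat.isCoprime_iff_coprime.2 hmr.symm).dvd_of_dvd_mul_left e3
            have := Int.natAbs_dvd_natAbs.2 h3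
            simpa using this
          rw [if_pos ⟨hT, hne, hrd⟩]
          have hrv : r ∣ vSh a m n₂ := by
            have := vSh_cast (ha n₂ hn₂)
            have h := hr₂; rw [← this] at h; exact_mod_cast h
          have hle : ∑ q₂ ∈ dyadic Q,
              (if P q₁ q₂ n₁ n₂ ∧ ((m * n₂ : ℕ) : ZMod (q₂ * r)) = (a : ZMod (q₂ * r)) then |γ q₂| else 0) ≤
              ∑ q₂ ∈ dyadic Q,
              (if ((m * n₂ : ℕ) : ZMod (q₂ * r)) = (a : ZMod (q₂ * r)) then |γ q₂| else 0) := by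
            refine Finset.sum_le_sum fun q₂ _ => ?_
            by_cases h1 : ((m * n₂ : ℕ) : ZMod (q₂ * r)) = (a : ZMod (q₂ * r))
            · rw [if_pos h1]; split_ifs; exact le_rfl; exact abs_nonneg _
            · rw [if_neg h1, if_neg (fun h => h1 h.2)]
          refine hle.trans (hS.trans ?_)
          unfold vSh at hrv ⊢
          rw [if_pos hrv]
        · have hP' : ∀ q₂ ∈ dyadic Q, ¬(P q₁ q₂ n₁ n₂ ∧ ((m * n₂ : ℕ) : ZMod (q₂ * r)) = (a : ZMod (q₂ * r))) :=
            fun q₂ hq₂ h => hP ⟨q₂, hq₂, h⟩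
          rw [Finset.sum_eq_zero (fun q₂ hq₂ => if_neg (hP' q₂ hq₂))]
          split_ifs <;> positivity
    _ = ∑ n₂ ∈ (dyadic N).filter (fun n₂ => n₂ ∈ T ∧ n₂ ≠ n₁ ∧ r ∣ Int.natAbs ((n₁ : ℤ) - n₂)),
          (σ 0 (vSh a m n₂) : ℝ) ^ (B + 1) := (Finset.sum_filter _ _).symm
    _ = _ := by
        refine Finset.sum_congr ?_ fun _ _ => rfl
        ext n₂
        simp only [Finset.mem_filter]
        constructor
        · rintro ⟨_, hT, hne, hrd⟩; exact ⟨hT, hne, hrd⟩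
        · rintro ⟨hT, hne, hrd⟩; exact ⟨hTN hT, hT, hne, hrd⟩


/-- **The `m`-sum by Lemma 3** (BFI (6.3)–(6.4): "by Lemma 3"): for `(q₁r, a) = 1`, with `k = q₁r`,
`∑_{m ∈ mRange, mn₁ ≡ a (k)} f(m) ∑_{n₂ ∈ T'} τ(mn₂−a)^{B+1} ≤ ∑_{n₂ ∈ T'} C₃ ((2M+Y)/k) (τ(q₁)τ(r)τ(n₂) lg)^{B₃}`,
given Lemma 3 (`hL3`, exponent `B+1`) at `X = (2M+Y)n₂`, modulus `k n₂ ≤ X^{1−ε₃}` (`hlev`),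
`X₀ ≤ (2M+Y)N`, and `log((2M+Y)n) ≤ lg` on `n ∼ N`. [cite: BombieriFriedlanderIwaniecActa1986, §6 (6.3)–(6.4) p. 220, §2 Lemma 3 p. 211] -/
theorem sum_m_cong_mul_sum_le {a : ℤ} {M Y N B : ℝ} (hY : 0 < Y) (hYM : Y ≤ M)
    (haM : (|a| : ℝ) < M - Y) (hN : 0 ≤ N) (hB : 0 ≤ B) {T' : Finset ℕ} (hT' : T' ⊆ dyadic N)
    {r q₁ n₁ : ℕ} (hr : 0 < r) (hq₁ : 0 < q₁) (hcop : IsCoprime ((q₁ * r : ℕ) : ℤ) a)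
    {C₃ B₃ X₀ ε₃ lg : ℝ} (hC₃ : 0 ≤ C₃) (hB₃ : 0 ≤ B₃)
    (hL3 : ∀ X : ℝ, X₀ ≤ X → ∀ k : ℕ, 0 < k → (k : ℝ) ≤ X ^ (1 - ε₃) → ∀ l : ZMod k,
      ∑ v ∈ l3Set a X k l, l3Term a (B + 1) v ≤ C₃ * (X / k) * ((σ 0 k : ℝ) * Real.log X) ^ B₃)
    (hX₀ : X₀ ≤ (2 * M + Y) * N)
    (hlev : ∀ n ∈ dyadic N, ((q₁ * r * n : ℕ) : ℝ) ≤ ((2 * M + Y) * n) ^ (1 - ε₃))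
    (hlg : ∀ n ∈ dyadic N, 0 ≤ Real.log ((2 * M + Y) * n) ∧ Real.log ((2 * M + Y) * n) ≤ lg) :
    ∑ m ∈ (mRange M Y).filter (fun m : ℕ => ((m * n₁ : ℕ) : ZMod (q₁ * r)) = (a : ZMod (q₁ * r))),
        bump M Y m * ∑ n₂ ∈ T', (σ 0 (vSh a m n₂) : ℝ) ^ (B + 1) ≤
      ∑ n₂ ∈ T', C₃ * ((2 * M + Y) / ((q₁ * r : ℕ) : ℝ)) *
        ((σ 0 q₁ : ℝ) * (σ 0 r : ℝ) * (σ 0 n₂ : ℝ) * lg) ^ B₃ := by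
  classical
  have hM : 0 ≤ M := hY.le.trans hYM
  have hk : 0 < q₁ * r := Nat.mul_pos hq₁ hr
  haveI : NeZero (q₁ * r) := ⟨hk.ne'⟩
  set Sm := (mRange M Y).filter (fun m : ℕ => ((m * n₁ : ℕ) : ZMod (q₁ * r)) = (a : ZMod (q₁ * r)))
    with hSm
  -- swap the sums
  rw [show ∑ m ∈ Sm, bump M Y m * ∑ n₂ ∈ T', (σ 0 (vSh a m n₂) : ℝ) ^ (B + 1) =
      ∑ n₂ ∈ T', ∑ m ∈ Sm, bump M Y m * (σ 0 (vSh a m n₂) : ℝ) ^ (B + 1) by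
    simp only [Finset.mul_sum]; rw [Finset.sum_comm]]
  refine Finset.sum_le_sum fun n₂ hn₂ => ?_
  have hn₂N := hT' hn₂
  have hn₂b := (mem_dyadic hN).1 hn₂N
  have hn₂0 : 0 < n₂ := pos_of_mem_dyadic hN hn₂N
  have hMY : 0 < 2 * M + Y := by linarith
  -- empty or a genuine class
  by_cases hne : Sm.Nonempty
  · obtain ⟨m₀, hm₀⟩ := hne
    rw [hSm, Finset.mem_filter] at hm₀
    obtain ⟨_, hn₁u⟩ := coprime_of_mul_congr hk hcop hm₀.2
    have hu : IsUnit (n₁ : ZMod (q₁ * r)) := (ZMod.isUnit_iff_coprime n₁ (q₁ * r)).2 hn₁u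
    set c : ZMod (q₁ * r) := (a : ZMod (q₁ * r)) * (n₁ : ZMod (q₁ * r))⁻¹ with hc
    have hSe : Sm = (mRange M Y).filter (fun m : ℕ => (m : ZMod (q₁ * r)) = c) := by
      rw [hSm]
      refine Finset.filter_congr fun m _ => ?_
      rw [hc, Nat.cast_mul]
      constructor
      · intro h; rw [← h, mul_assoc, ZMod.mul_inv_of_unit _ hu, mul_one]
      · intro h; rw [h, mul_assoc, ZMod.inv_mul_of_unit _ hu, mul_one]
    rw [hSe]
    have h1 := sum_mRange_class_bump_rpow_sigma_sub_le_l3 (a := a) (A := B + 1) (by linarith) hY hYM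
      haM hk hn₂0 c
    refine (le_of_eq_of_le (Finset.sum_congr rfl fun m _ => by rfl) (h1.trans ?_))
    -- Lemma 3
    have hX : X₀ ≤ (2 * M + Y) * n₂ := hX₀.trans (by nlinarith [hn₂b.1])
    have hkn : 0 < q₁ * r * n₂ := Nat.mul_pos hk hn₂0
    have hlev' : ((q₁ * r * n₂ : ℕ) : ℝ) ≤ ((2 * M + Y) * n₂) ^ (1 - ε₃) := hlev n₂ hn₂N
    have h2 := hL3 ((2 * M + Y) * n₂) hX (q₁ * r * n₂) hkn hlev' ((c.val * n₂ : ℕ) : ZMod (q₁ * r * n₂))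
    refine h2.trans ?_
    obtain ⟨hlg0, hlg1⟩ := hlg n₂ hn₂N
    have e1 : (2 * M + Y) * n₂ / ((q₁ * r * n₂ : ℕ) : ℝ) = (2 * M + Y) / ((q₁ * r : ℕ) : ℝ) := by
      have hn₂r : (0 : ℝ) < n₂ := by exact_mod_cast hn₂0
      push_cast
      field_simp
    rw [e1]
    refine mul_le_mul_of_nonneg_left ?_ (by positivity)
    refine Real.rpow_le_rpow (by positivity) ?_ hB₃
    have hτ : (σ 0 (q₁ * r * n₂) : ℝ) ≤ (σ 0 q₁ : ℝ) * (σ 0 r : ℝ) * (σ 0 n₂ : ℝ) := by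
      have h1 := sigma_zero_mul_le (q₁ * r) n₂
      have h2 := sigma_zero_mul_le q₁ r
      calc (σ 0 (q₁ * r * n₂) : ℝ) ≤ ((σ 0 (q₁ * r) * σ 0 n₂ : ℕ) : ℝ) := by exact_mod_cast h1
        _ ≤ ((σ 0 q₁ * σ 0 r * σ 0 n₂ : ℕ) : ℝ) := by exact_mod_cast Nat.mul_le_mul_right _ h2
        _ = _ := by push_cast; ring
    exact mul_le_mul hτ hlg1 hlg0 (by positivity)
  · rw [Finset.not_nonempty_iff_eq_empty.1 hne, Finset.sum_empty]
    obtain ⟨hlg0, hlg1⟩ := hlg n₂ hn₂N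
    have : 0 ≤ lg := hlg0.trans hlg1
    positivity


/-- `∑_{r ∼ R, r ∣ d} τ(r)^{B₃}/r ≤ τ(d)^{B₃+1}/R` for `d ≥ 1`, `R > 0`. [folklore] -/
theorem sum_dyadic_ite_dvd_rpow_div_le {R B₃ : ℝ} (hR : 0 < R) (hB₃ : 0 ≤ B₃) {d : ℕ} (hd : 0 < d) :
    ∑ r ∈ dyadic R, (if r ∣ d then (σ 0 r : ℝ) ^ B₃ / r else 0) ≤ (σ 0 d : ℝ) ^ (B₃ + 1) / R := by
  rw [← Finset.sum_filter]
  calc ∑ r ∈ (dyadic R).filter (fun r => r ∣ d), (σ 0 r : ℝ) ^ B₃ / r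
      ≤ ∑ r ∈ (dyadic R).filter (fun r => r ∣ d), (σ 0 r : ℝ) ^ B₃ / R := by
        refine Finset.sum_le_sum fun r hr => ?_
        have hrb := (mem_dyadic hR.le).1 (Finset.mem_filter.1 hr).1
        exact div_le_div_of_nonneg_left (by positivity) hR hrb.1.le
    _ = (∑ r ∈ (dyadic R).filter (fun r => r ∣ d), (σ 0 r : ℝ) ^ B₃) / R := by
        rw [Finset.sum_div]
    _ ≤ (σ 0 d : ℝ) ^ (B₃ + 1) / R :=
        div_le_div_of_nonneg_right (sum_dyadic_dvd_rpow_sigma_le hd R hB₃) hR.le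

set_option maxHeartbeats 400000 in
/-- **The off-diagonal sums of `𝒮₁ᶜ` against an admissible set `T`** (the common skeleton of the two
Cauchy factors): with `P` forcing `n₂ ∈ T`, `n₂ ≠ n₁`, and the hypotheses of
`BFI.sum_m_cong_mul_sum_le` (Lemma 3 with exponent `B+1`, level `q₁rn ≤ ((2M+Y)n)^{1−ε₃}`),
`restSum[P] ≤ C₃ (2M+Y) lg^{B₃} Γ R⁻¹ ‖β‖² U`, where `Γ = ∑_{q∼Q} |γ_q| τ(q)^{B₃}/q` and
`U ≥ ∑_{n₂ ∈ T, n₂ ≠ n₁} τ(n₂)^{B₃} τ(|n₁−n₂|)^{B₃+1}` for every `n₁ ∼ N` (the `r ∼ R` dividing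
`n₁ − n₂` being summed first: `∑_{r∣d} τ(r)^{B₃}/r ≤ τ(d)^{B₃+1}/R`).
[cite: BombieriFriedlanderIwaniecActa1986, §6 (6.3)–(6.4), (6.8) p. 220] -/
theorem restSum_le_of_subset {a : ℤ} {M Y N Q R B : ℝ} (hY : 0 < Y) (hYM : Y ≤ M)
    (haM : (|a| : ℝ) < M - Y) (hN : 0 ≤ N) (hQ : 0 < Q) (hR : 0 < R) (hB : 0 ≤ B) {γ : ℕ → ℝ}
    (hγ : ∀ q, |γ q| ≤ (σ 0 q : ℝ) ^ B) (β : ℕ → ℝ) (P : ℕ → ℕ → ℕ → ℕ → Prop)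
    [∀ q₁ q₂ n₁ n₂, Decidable (P q₁ q₂ n₁ n₂)] {T : Finset ℕ} (hT : T ⊆ dyadic N)
    (hPT : ∀ q₁ q₂ n₁ n₂, n₂ ∈ dyadic N → P q₁ q₂ n₁ n₂ → n₂ ∈ T ∧ n₂ ≠ n₁)
    {C₃ B₃ X₀ ε₃ lg U : ℝ} (hC₃ : 0 ≤ C₃) (hB₃ : 0 ≤ B₃) (hlg0 : 0 ≤ lg)
    (hL3 : ∀ X : ℝ, X₀ ≤ X → ∀ k : ℕ, 0 < k → (k : ℝ) ≤ X ^ (1 - ε₃) → ∀ l : ZMod k,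
      ∑ v ∈ l3Set a X k l, l3Term a (B + 1) v ≤ C₃ * (X / k) * ((σ 0 k : ℝ) * Real.log X) ^ B₃)
    (hX₀ : X₀ ≤ (2 * M + Y) * N)
    (hlev : ∀ q₁ ∈ dyadic Q, ∀ r ∈ dyadic R, ∀ n ∈ dyadic N,
      ((q₁ * r * n : ℕ) : ℝ) ≤ ((2 * M + Y) * n) ^ (1 - ε₃))
    (hlg : ∀ n ∈ dyadic N, 0 ≤ Real.log ((2 * M + Y) * n) ∧ Real.log ((2 * M + Y) * n) ≤ lg)
    (hU : ∀ n₁ ∈ dyadic N, ∑ n₂ ∈ T.filter (fun n₂ => n₂ ≠ n₁),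
      (σ 0 n₂ : ℝ) ^ B₃ * tauDiff n₁ n₂ ^ (B₃ + 1) ≤ U) :
    restSum a (mRange M Y) N Q R (fun m => bump M Y m) β γ P ≤
      C₃ * (2 * M + Y) * lg ^ B₃ * (∑ q ∈ dyadic Q, |γ q| * (σ 0 q : ℝ) ^ B₃ / q) * R⁻¹ *
        l2Sq N β * U := by
  classical
  have hM : 0 ≤ M := hY.le.trans hYM
  have hw : ∀ m ∈ mRange M Y, 0 ≤ bump M Y m := fun m _ => (bump_mem_Icc hY hM _).1
  have hMY : 0 < 2 * M + Y := by linarith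
  -- `lg ≥ 0` (from any `n ∼ N`, if the range is nonempty; otherwise everything is `0`)
  set Γ : ℝ := ∑ q ∈ dyadic Q, |γ q| * (σ 0 q : ℝ) ^ B₃ / q with hΓ
  have hΓ0 : 0 ≤ Γ := Finset.sum_nonneg fun q _ => by positivity
  have hl2 : 0 ≤ l2Sq N β := Finset.sum_nonneg fun _ _ => sq_nonneg _
  -- the inner bound `G`
  set G : ℕ → ℕ → ℕ → ℕ → ℝ := fun m r q₁ n₁ =>
    ∑ n₂ ∈ T.filter (fun n₂ => n₂ ≠ n₁ ∧ r ∣ Int.natAbs ((n₁ : ℤ) - n₂)),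
      (σ 0 (vSh a m n₂) : ℝ) ^ (B + 1) with hG
  have hGb : ∀ r ∈ dyadic R, ∀ q₁ ∈ dyadic Q, ∀ n₁ ∈ dyadic N, β n₁ ≠ 0 →
      ∀ m ∈ mRange M Y, bump M Y m ≠ 0 →
      IsCoprime ((q₁ * r : ℕ) : ℤ) a → ((m * n₁ : ℕ) : ZMod (q₁ * r)) = (a : ZMod (q₁ * r)) →
      innerP a N Q γ P m r q₁ n₁ ≤ G m r q₁ n₁ := by
    intro r hr q₁ hq₁ n₁ hn₁ _ m hm hbm hcop hc
    obtain ⟨_, _, _, ha⟩ := mRange_bump_facts hY hYM haM hm hbm (a := a)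
    exact innerP_le_sum_filter hB hγ P (pos_of_mem_dyadic hR.le hr) (pos_of_mem_dyadic hQ.le hq₁)
      (fun q₂ n₂ hn₂ hP => hPT q₁ q₂ n₁ n₂ hn₂ hP) hT hcop hc (ha hN)
  refine (restSum_le_of_innerP_le a N Q R hw β γ P hGb).trans ?_
  -- abbreviation for the summand after Lemma 3
  set K : ℝ := C₃ * (2 * M + Y) * lg ^ B₃ with hK
  have hK0 : 0 ≤ K := by positivity
  set F : ℕ → ℕ → ℕ → ℕ → ℝ := fun r q₁ n₁ n₂ =>
    K * (|γ q₁| * (σ 0 q₁ : ℝ) ^ B₃ / q₁) * β n₁ ^ 2 *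
      ((σ 0 n₂ : ℝ) ^ B₃ * (if r ∣ Int.natAbs ((n₁ : ℤ) - n₂) then (σ 0 r : ℝ) ^ B₃ / r else 0)) with hF
  -- the `m`-sums by Lemma 3, termwise in `(r, q₁, n₁)`
  have hstep : ∀ r ∈ dyadic R, ∀ q₁ ∈ dyadic Q, ∀ n₁ ∈ dyadic N,
      (if IsCoprime ((q₁ * r : ℕ) : ℤ) a then
        |γ q₁| * β n₁ ^ 2 * ∑ m ∈ (mRange M Y).filter
            (fun m : ℕ => ((m * n₁ : ℕ) : ZMod (q₁ * r)) = (a : ZMod (q₁ * r))),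
          bump M Y m * G m r q₁ n₁ else 0) ≤
      ∑ n₂ ∈ T.filter (fun n₂ => n₂ ≠ n₁), F r q₁ n₁ n₂ := by
    intro r hr q₁ hq₁ n₁ hn₁
    have hr0 := pos_of_mem_dyadic hR.le hr
    have hq₁0 := pos_of_mem_dyadic hQ.le hq₁
    have hr0' : (0 : ℝ) < r := by exact_mod_cast hr0
    have hq₁0' : (0 : ℝ) < q₁ := by exact_mod_cast hq₁0
    -- identify the right-hand side with the Lemma-3 output
    have hRHS : ∑ n₂ ∈ T.filter (fun n₂ => n₂ ≠ n₁), F r q₁ n₁ n₂ =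
        |γ q₁| * β n₁ ^ 2 * ∑ n₂ ∈ T.filter (fun n₂ : ℕ => n₂ ≠ n₁ ∧ r ∣ Int.natAbs ((n₁ : ℤ) - n₂)),
          C₃ * ((2 * M + Y) / ((q₁ * r : ℕ) : ℝ)) *
            ((σ 0 q₁ : ℝ) * (σ 0 r : ℝ) * (σ 0 n₂ : ℝ) * lg) ^ B₃ := by
      rw [Finset.mul_sum]
      rw [show T.filter (fun n₂ : ℕ => n₂ ≠ n₁ ∧ r ∣ Int.natAbs ((n₁ : ℤ) - n₂)) =
          (T.filter (fun n₂ : ℕ => n₂ ≠ n₁)).filter (fun n₂ : ℕ => r ∣ Int.natAbs ((n₁ : ℤ) - (n₂ : ℤ))) by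
        rw [Finset.filter_filter]]
      conv_rhs => rw [Finset.sum_filter]
      refine Finset.sum_congr rfl fun n₂ _ => ?_
      simp only [hF]
      split_ifs with hd
      · rw [Real.mul_rpow (by positivity) hlg0, Real.mul_rpow (by positivity) (by positivity),
          Real.mul_rpow (by positivity) (by positivity), hK]
        push_cast
        field_simp
      · simp
    rw [hRHS]
    have hrhs : 0 ≤ |γ q₁| * β n₁ ^ 2 * ∑ n₂ ∈ T.filter (fun n₂ : ℕ => n₂ ≠ n₁ ∧ r ∣ Int.natAbs ((n₁ : ℤ) - n₂)),
        C₃ * ((2 * M + Y) / ((q₁ * r : ℕ) : ℝ)) *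
          ((σ 0 q₁ : ℝ) * (σ 0 r : ℝ) * (σ 0 n₂ : ℝ) * lg) ^ B₃ :=
      mul_nonneg (by positivity) (Finset.sum_nonneg fun n₂ _ => by positivity)
    by_cases hcop : IsCoprime ((q₁ * r : ℕ) : ℤ) a
    · rw [if_pos hcop]
      refine mul_le_mul_of_nonneg_left ?_ (by positivity)
      have hT'' : T.filter (fun n₂ : ℕ => n₂ ≠ n₁ ∧ r ∣ Int.natAbs ((n₁ : ℤ) - n₂)) ⊆ dyadic N :=
        (Finset.filter_subset _ _).trans hT
      exact sum_m_cong_mul_sum_le hY hYM haM hN hB hT'' hr0 hq₁0 hcop hC₃ hB₃ hL3 hX₀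
        (fun n hn => hlev q₁ hq₁ r hr n hn) hlg
    · rw [if_neg hcop]; exact hrhs
  -- the `r`-sum: `∑_{r ∣ d} τ(r)^{B₃}/r ≤ τ(d)^{B₃+1}/R`
  have hrsum : ∀ q₁ ∈ dyadic Q, ∀ n₁ ∈ dyadic N, ∀ n₂ ∈ T.filter (fun n₂ => n₂ ≠ n₁),
      ∑ r ∈ dyadic R, F r q₁ n₁ n₂ ≤
        K * (|γ q₁| * (σ 0 q₁ : ℝ) ^ B₃ / q₁) * β n₁ ^ 2 *
          ((σ 0 n₂ : ℝ) ^ B₃ * (tauDiff n₁ n₂ ^ (B₃ + 1) / R)) := by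
    intro q₁ _ n₁ _ n₂ hn₂
    obtain ⟨_, hne⟩ := Finset.mem_filter.1 hn₂
    simp only [hF]
    rw [← Finset.mul_sum, ← Finset.mul_sum]
    refine mul_le_mul_of_nonneg_left (mul_le_mul_of_nonneg_left ?_ (by positivity)) (by positivity)
    have hd : 0 < Int.natAbs ((n₁ : ℤ) - n₂) := by rw [Int.natAbs_pos]; omega
    unfold tauDiff
    exact sum_dyadic_ite_dvd_rpow_div_le hR hB₃ hd
  calc _ ≤ ∑ r ∈ dyadic R, ∑ q₁ ∈ dyadic Q, ∑ n₁ ∈ dyadic N, ∑ n₂ ∈ T.filter (fun n₂ => n₂ ≠ n₁),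
          F r q₁ n₁ n₂ :=
        Finset.sum_le_sum fun r hr => Finset.sum_le_sum fun q₁ hq₁ => Finset.sum_le_sum fun n₁ hn₁ =>
          hstep r hr q₁ hq₁ n₁ hn₁
    _ = ∑ q₁ ∈ dyadic Q, ∑ n₁ ∈ dyadic N, ∑ n₂ ∈ T.filter (fun n₂ => n₂ ≠ n₁),
          ∑ r ∈ dyadic R, F r q₁ n₁ n₂ := by
        rw [Finset.sum_comm]
        refine Finset.sum_congr rfl fun q₁ _ => ?_
        rw [Finset.sum_comm]
        refine Finset.sum_congr rfl fun n₁ _ => ?_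
        rw [Finset.sum_comm]
    _ ≤ ∑ q₁ ∈ dyadic Q, ∑ n₁ ∈ dyadic N, ∑ n₂ ∈ T.filter (fun n₂ => n₂ ≠ n₁),
          K * (|γ q₁| * (σ 0 q₁ : ℝ) ^ B₃ / q₁) * β n₁ ^ 2 *
            ((σ 0 n₂ : ℝ) ^ B₃ * (tauDiff n₁ n₂ ^ (B₃ + 1) / R)) :=
        Finset.sum_le_sum fun q₁ hq₁ => Finset.sum_le_sum fun n₁ hn₁ =>
          Finset.sum_le_sum fun n₂ hn₂ => hrsum q₁ hq₁ n₁ hn₁ n₂ hn₂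
    _ = K * R⁻¹ * ∑ q₁ ∈ dyadic Q, (|γ q₁| * (σ 0 q₁ : ℝ) ^ B₃ / q₁) *
          ∑ n₁ ∈ dyadic N, β n₁ ^ 2 * ∑ n₂ ∈ T.filter (fun n₂ => n₂ ≠ n₁),
            (σ 0 n₂ : ℝ) ^ B₃ * tauDiff n₁ n₂ ^ (B₃ + 1) := by
        simp only [Finset.mul_sum]
        refine Finset.sum_congr rfl fun q₁ _ => Finset.sum_congr rfl fun n₁ _ =>
          Finset.sum_congr rfl fun n₂ _ => ?_
        rw [div_eq_mul_inv _ R]; ring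
    _ ≤ K * R⁻¹ * ∑ q₁ ∈ dyadic Q, (|γ q₁| * (σ 0 q₁ : ℝ) ^ B₃ / q₁) * (l2Sq N β * U) := by
        refine mul_le_mul_of_nonneg_left (Finset.sum_le_sum fun q₁ _ =>
          mul_le_mul_of_nonneg_left ?_ (by positivity)) (by positivity)
        unfold l2Sq
        rw [Finset.sum_mul]
        exact Finset.sum_le_sum fun n₁ hn₁ => mul_le_mul_of_nonneg_left (hU n₁ hn₁) (sq_nonneg _)
    _ = _ := by rw [hK, ← Finset.sum_mul]; ring


/-- On the main range two coprime `n₁, n₂ ∼ N` (`N ≥ 1`) are distinct. [folklore] -/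
theorem ne_of_main {Q₀ N : ℝ} (hN : 1 ≤ N) {q₁ q₂ n₁ n₂ : ℕ} (hn₂ : n₂ ∈ dyadic N)
    (h : Main Q₀ q₁ q₂ n₁ n₂) : n₂ ≠ n₁ := by
  rintro rfl
  have h1 : n₂ = 1 := by simpa using h.1
  have := ((mem_dyadic (by linarith)).1 hn₂).1
  rw [h1] at this; push_cast at this; linarith

/-- **The non-squarefree pairs of `𝒮₁ᶜ` are negligible** (BFI (6.8) p. 220: "Due to (A₄) the terms
in `𝒮₁*` with `n₁n₂` not squarefree can be removed with admissible error as in (6.4)"), in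
structural form: for the smoothed sum (`S = mRange`, `w = bump M Y`, `0 < Y ≤ M`, `|a| < M − Y`),
`N ≥ 1`, `Q, R > 0`, `|γ_q| ≤ τ(q)^B`, Lemma 3 with exponent `B + 1` (`hL3`, from
`BombieriFriedlanderIwaniecLemma3_holds` in the assembly) at the level `q₁ r n ≤ ((2M+Y)n)^{1−ε₃}`,
and bounds `U₁`, `U₂ > 0` for the shifted divisor sums over the exceptional set
`Bad = {n ∼ N : μ²(n) = 0, β_n ≠ 0}` and over all `n ∼ N`:
`|𝒮₁ᶜ(β) − 𝒮₁ᶜ(β♭)| ≤ 2 C₃ (2M+Y) lg^{B₃} Γ R⁻¹ ‖β‖² (U₁U₂)^{1/2}`,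
`Γ = ∑_{q∼Q} |γ_q|τ(q)^{B₃}/q`.  With `#Bad ≤ 4N/N₀` ((A₄), `BFI.card_nsf_support_le`) and the
divisor moments, `U₁ ≪ N ℒ^c N₀^{−1/2}`, `U₂ ≪ N ℒ^c`, so this is `≪ ‖β‖² x R⁻¹ ℒ^c N₀^{−1/4}`.
[cite: BombieriFriedlanderIwaniecActa1986, §6 (6.4), (6.8) p. 220] -/
theorem abs_dS1c_sub_sqfPart_le {a : ℤ} {M Y N Q R Q₀ B : ℝ} (hY : 0 < Y) (hYM : Y ≤ M)
    (haM : (|a| : ℝ) < M - Y) (hN : 1 ≤ N) (hQ : 0 < Q) (hR : 0 < R) (hB : 0 ≤ B) {γ : ℕ → ℝ}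
    (hγ : ∀ q, |γ q| ≤ (σ 0 q : ℝ) ^ B) (β : ℕ → ℝ)
    {C₃ B₃ X₀ ε₃ lg U₁ U₂ : ℝ} (hC₃ : 0 ≤ C₃) (hB₃ : 0 ≤ B₃) (hlg0 : 0 ≤ lg) (hU₁ : 0 < U₁)
    (hU₂ : 0 < U₂)
    (hL3 : ∀ X : ℝ, X₀ ≤ X → ∀ k : ℕ, 0 < k → (k : ℝ) ≤ X ^ (1 - ε₃) → ∀ l : ZMod k,
      ∑ v ∈ l3Set a X k l, l3Term a (B + 1) v ≤ C₃ * (X / k) * ((σ 0 k : ℝ) * Real.log X) ^ B₃)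
    (hX₀ : X₀ ≤ (2 * M + Y) * N)
    (hlev : ∀ q₁ ∈ dyadic Q, ∀ r ∈ dyadic R, ∀ n ∈ dyadic N,
      ((q₁ * r * n : ℕ) : ℝ) ≤ ((2 * M + Y) * n) ^ (1 - ε₃))
    (hlg : ∀ n ∈ dyadic N, 0 ≤ Real.log ((2 * M + Y) * n) ∧ Real.log ((2 * M + Y) * n) ≤ lg)
    (hU₁b : ∀ n₁ ∈ dyadic N, ∑ n₂ ∈ (badSet N β).filter (fun n₂ => n₂ ≠ n₁),
      (σ 0 n₂ : ℝ) ^ B₃ * tauDiff n₁ n₂ ^ (B₃ + 1) ≤ U₁)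
    (hU₂b : ∀ n₁ ∈ dyadic N, ∑ n₂ ∈ (dyadic N).filter (fun n₂ => n₂ ≠ n₁),
      (σ 0 n₂ : ℝ) ^ B₃ * tauDiff n₁ n₂ ^ (B₃ + 1) ≤ U₂) :
    |dS1c a (mRange M Y) N Q R Q₀ (fun m => bump M Y m) β γ -
        dS1c a (mRange M Y) N Q R Q₀ (fun m => bump M Y m) (sqfPart β) γ| ≤
      2 * (C₃ * (2 * M + Y) * lg ^ B₃ * (∑ q ∈ dyadic Q, |γ q| * (σ 0 q : ℝ) ^ B₃ / q) * R⁻¹ *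
        l2Sq N β) * (Real.sqrt U₁ * Real.sqrt U₂) := by
  classical
  have hM : 0 ≤ M := hY.le.trans hYM
  have hN0 : 0 ≤ N := by linarith
  have hw : ∀ m ∈ mRange M Y, 0 ≤ bump M Y m := fun m _ => (bump_mem_Icc hY hM _).1
  set K' : ℝ := C₃ * (2 * M + Y) * lg ^ B₃ * (∑ q ∈ dyadic Q, |γ q| * (σ 0 q : ℝ) ^ B₃ / q) * R⁻¹ *
    l2Sq N β with hK'
  -- the two Cauchy factors
  have h1 : restSum a (mRange M Y) N Q R (fun m => bump M Y m) β γ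
      (fun q₁ q₂ n₁ n₂ => Main Q₀ q₁ q₂ n₁ n₂ ∧ n₂ ∈ badSet N β) ≤ K' * U₁ :=
    restSum_le_of_subset hY hYM haM hN0 hQ hR hB hγ β _ (badSet_subset N β)
      (fun q₁ q₂ n₁ n₂ hn₂ hP => ⟨hP.2, ne_of_main hN hn₂ hP.1⟩) hC₃ hB₃ hlg0 hL3 hX₀ hlev hlg hU₁b
  have h2 : restSum a (mRange M Y) N Q R (fun m => bump M Y m) β γ
      (fun q₁ q₂ n₁ n₂ => Main Q₀ q₁ q₂ n₁ n₂) ≤ K' * U₂ :=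
    restSum_le_of_subset hY hYM haM hN0 hQ hR hB hγ β _ (subset_refl _)
      (fun q₁ q₂ n₁ n₂ hn₂ hP => ⟨hn₂, ne_of_main hN hn₂ hP⟩) hC₃ hB₃ hlg0 hL3 hX₀ hlev hlg hU₂b
  -- optimise `θ`
  set θ : ℝ := Real.sqrt U₂ / Real.sqrt U₁ with hθ
  have hsU₁ : 0 < Real.sqrt U₁ := Real.sqrt_pos.2 hU₁
  have hsU₂ : 0 < Real.sqrt U₂ := Real.sqrt_pos.2 hU₂
  have hθ0 : 0 < θ := div_pos hsU₂ hsU₁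
  have hV := vBad_le a N Q R Q₀ hw β γ hθ0 (S := mRange M Y)
  have hK'0 : 0 ≤ K' := by
    have : 0 ≤ l2Sq N β := Finset.sum_nonneg fun _ _ => sq_nonneg _
    have : 0 ≤ ∑ q ∈ dyadic Q, |γ q| * (σ 0 q : ℝ) ^ B₃ / q := Finset.sum_nonneg fun _ _ => by positivity
    positivity
  have key : θ / 2 * (K' * U₁) + 1 / (2 * θ) * (K' * U₂) = K' * (Real.sqrt U₁ * Real.sqrt U₂) := by
    have e1 : K' * U₁ = K' * (Real.sqrt U₁ * Real.sqrt U₁) := by rw [Real.mul_self_sqrt hU₁.le]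
    have e2 : K' * U₂ = K' * (Real.sqrt U₂ * Real.sqrt U₂) := by rw [Real.mul_self_sqrt hU₂.le]
    rw [e1, e2, hθ]
    field_simp
    ring
  calc _ ≤ 2 * vBad a (mRange M Y) N Q R Q₀ (fun m => bump M Y m) β γ :=
        abs_dS1c_sub_sqfPart_le_two_mul_vBad a N Q R Q₀ hw β γ
    _ ≤ 2 * (θ / 2 * (K' * U₁) + 1 / (2 * θ) * (K' * U₂)) := by
        refine mul_le_mul_of_nonneg_left (hV.trans ?_) (by norm_num)
        gcongr
    _ = 2 * K' * (Real.sqrt U₁ * Real.sqrt U₂) := by rw [key]; ring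

end BFI

end Literature.NumberTheory.Sieve
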